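import Literature.Barriers.AtomisticToContinuum.OneDimensionalHardCore
import Mathlib.LinearAlgebra.Vandermonde
import Mathlib.LinearAlgebra.Matrix.Adjugate
import Mathlib.Logic.Equiv.Fin.Rotate
import Mathlib.Analysis.Complex.Trigonometric
import Mathlib.MeasureTheory.Integral.Pi
import Mathlib.Analysis.Matrix.Spectrum
import Mathlib.Analysis.SpecialFunctions.Integrals.Basic
import Mathlib.MeasureTheory.Integral.Bochner.ContinuousLinearMap
import Mathlib.Analysis.PSeries
import Mathlib.MeasureTheory.Integral.DominatedConvergence
import Mathlib.Analysis.SpecialFunctions.Exp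
import Mathlib.Analysis.Real.Sqrt
import Mathlib.Analysis.Complex.Exponential

/-!
# Proof of the barrier fact `OneDimensionalHardCore` (no ground-state BEC for 1D hard-core bosons)

This file discharges the named fact
`Literature.Barriers.AtomisticToContinuum.OneDimensionalHardCore` of
`Literature/Barriers/AtomisticToContinuum/OneDimensionalHardCore.lean`:
for every `L > 0` the zero-momentum occupation `c₀(N)` of Girardeau's ground state of `N`
impenetrable bosons on a ring of circumference `L` satisfies `c₀(N)/N → 0`
(`OneDimensionalHardCore_holds`, at the end of the file).

The printed route to the sharp law `c₀(N) ∼ 1.5427 √N` [ForresterEtAl2003, §2.2.2] goes through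
the `√N |sin t|^{-1/2}` asymptotics of Lenard's Toeplitz determinant (Lenard 1972, Widom 1973)
[ForresterEtAl2003, §2.1.4], which is far beyond Mathlib.  The weaker typed statement `c₀(N) = o(N)`
is proved here by an elementary argument built on the same exact identities:

* **Part A** (`girardeauState_eq_norm_det`, `eL_factor_identity`, `sgnFun_mul_eq_abs`):
  `ψ_N = (N! L^N)^{-1/2} |det V(e(x_j))|` with `e(x) = e^{2πix/L}` [ForresterEtAl2003, §2.1.1], and
  Girardeau's Bose–Fermi sign trick for two insertion points `a, b`:
  `∏_j |e(x_j)-e(a)||e(x_j)-e(b)| = e^{-iπn(a-b)/L} ∏_j s(x_j) ∏_j (e(x_j)-e(a)) conj(e(x_j)-e(b))`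
  with `s = 1 - 2·𝟙_{(a,b)}`.
* **Part B** (`integral_det_mul_det`): Andréief's identity
  `∫ det[F_t(x_r)] det[G_t(x_r)] dμ^{⊗n} = n! det[∫ F_t G_{t'} dμ]`, the two-function form of the
  Heine identity of [ForresterEtAl2003, §2.1.2].
* **Parts C–E** (`integral_sgn_det_det`, `sgn_det_det_eq_girardeau`, `density_eq_adjugate`):
  Laplace expansion along the inserted point and Andréief give **Lenard's formula** in cofactor
  form, `ρ_{n+1}(a,b) = L⁻¹ e^{-iπn(a-b)/L} ⟨u(b), adj(M) u(a)⟩`, where `u(a)_p = e(a)^p` and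
  `M = 1 - 2Q`, `Q_{kl} = q(k-l)`, `q(m) = L⁻¹ ∫_{(a,b)} e^{2πimx/L} dx` (`lenardMatrix`); this is
  equivalent to the Toeplitz form `ϱ_N = det[γ_{j-k}]` of [ForresterEtAl2003, §2.1.2] and
  reproduces the printed `ϱ₂(t) = (2/π)[(π-2t)cos t + 2 sin t]`.
* **Part F** (`norm_star_dotProduct_adjugate_mulVec_le`): for Hermitian `M`,
  `|⟨x, adj(M) y⟩| ≤ e^{1/2} exp((tr M² - N)/2) ‖x‖‖y‖` (spectral theorem and `|ν| ≤ e^{(ν²-1)/2}`).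
* **Part G** (`re_trace_lenardMatrix_sq`, `sum_norm_sq_qCoeff_le`, `numVar_ge_harmonic`):
  `tr M² - N = -4 V_N` with `V_N = N|a-b|/L - ∑_{k,l<N} |q(k-l)|²` (the free-fermion number
  variance of the arc), Bessel's inequality for the plane waves, and the logarithmic divergence
  `V_N ≥ sin²(π(a-b)/L) H_N /(18π²)`, `H_N = ∑_{j<N} 1/(j+1)`.
* **Part H**: hence `ρ_N(a,b) ≤ (N/L) e^{1/2} exp(-sin²(π(a-b)/L) H_N/(9π²))` on `[0,L]²`, and
  dominated convergence (the majorant tends to `0` off the null set `a - b ∈ Lℤ`) gives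
  `c₀(N)/N ≤ (e^{1/2}/L²) ∫₀ᴸ∫₀ᴸ majorant → 0`.

## References

* [ForresterEtAl2003] P. J. Forrester, N. E. Frankel, T. M. Garoni, N. S. Witte, *Finite
  one-dimensional impenetrable Bose systems: occupation numbers*, Phys. Rev. A 67 (2003) 043607
  (arXiv:cond-mat/0211126): §2.1.1 (Girardeau state), §2.1.2 (Heine identity, Lenard's Toeplitz
  determinant, `ϱ₂`), §2.1.4 and §2.2.2 (the sharp `√N` asymptotics, not formalised).
* [Lenard1964] A. Lenard, J. Math. Phys. 5 (1964) 930–943 (the Toeplitz/expansion formulae and the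
  original `O(√N)` bounds; not re-read here).

## Design notes

All objects are the first-quantised ones of the statement file (`girardeauState`,
`girardeauDensityMatrix`, `zeroMomentumOccupation`); no statement or definition of that file is
changed.  Auxiliary definitions introduced here (`eL`, `sgnFun`, `uVec`, `gramS`, `ez`, `qCoeff`,
`lenardMatrix`, `numVar`, `majorant`) live in `Literature.BoseGas` and carry docstrings.
-/

noncomputable section

open MeasureTheory Filter Topology Finset Complex Matrix Equiv
open scoped BigOperators Real ComplexConjugate

namespace Literature.Barriers.AtomisticToContinuum.BoseGas

/-! ### Part A: trigonometric identities and the Vandermonde form of the Girardeau state -/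


/-- The plane wave `e_L(x) = exp(2π i x / L)`. [folklore] -/
def eL (L x : ℝ) : ℂ := cexp (↑(2 * π * x / L) * I)

/-- Plane waves have unit modulus. [folklore] -/
theorem norm_eL (L x : ℝ) : ‖eL L x‖ = 1 := by
  unfold eL; exact norm_exp_ofReal_mul_I _

/-- `e^{iα} − e^{iβ} = e^{i(α+β)/2} · 2i sin((α−β)/2)`. [folklore] -/
theorem exp_I_sub_exp_I (α β : ℝ) :
    cexp (α * I) - cexp (β * I) =
      cexp (↑((α + β) / 2) * I) * (2 * I * (Real.sin ((α - β) / 2) : ℂ)) := by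
  have h1 : cexp (α * I) = cexp (↑((α + β) / 2) * I) * cexp (↑((α - β) / 2) * I) := by
    rw [← Complex.exp_add]; congr 1; push_cast; ring
  have h2 : cexp (β * I) = cexp (↑((α + β) / 2) * I) * cexp (-↑((α - β) / 2) * I) := by
    rw [← Complex.exp_add]; congr 1; push_cast; ring
  rw [h1, h2, ofReal_sin, Complex.sin]
  set E := cexp (↑((α + β) / 2) * I)
  set P := cexp (↑((α - β) / 2) * I)
  set Q := cexp (-↑((α - β) / 2) * I)
  linear_combination (E * (P - Q)) * Complex.I_sq

/-- `|e^{iα} − e^{iβ}| = 2|sin((α−β)/2)|` (chord length). [folklore] -/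
theorem norm_exp_I_sub_exp_I (α β : ℝ) :
    ‖cexp (α * I) - cexp (β * I)‖ = 2 * |Real.sin ((α - β) / 2)| := by
  rw [exp_I_sub_exp_I, norm_mul, norm_exp_ofReal_mul_I, one_mul, norm_mul, norm_mul,
    Complex.norm_two, norm_I, mul_one, norm_real, Real.norm_eq_abs]

/-- `|e(u) − e(v)| = 2|sin(π(u−v)/L)|`, the identity behind the two printed forms of the
Girardeau state. [cite: ForresterEtAl2003, §2.1.1] -/
theorem norm_eL_sub_eL (L u v : ℝ) : ‖eL L u - eL L v‖ = 2 * |Real.sin (π * (u - v) / L)| := by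
  unfold eL
  rw [norm_exp_I_sub_exp_I]
  congr 3
  ring

/-- `e(a) - e(x) = exp(iπ(a+x)/L) · 2i sin(π(a-x)/L)`. [folklore] -/
theorem eL_sub_eL (L a x : ℝ) :
    eL L a - eL L x =
      cexp (↑(π * (a + x) / L) * I) * (2 * I * (Real.sin (π * (a - x) / L) : ℂ)) := by
  unfold eL
  rw [exp_I_sub_exp_I]
  congr 3
  · push_cast; ring
  · ring

/-- The key phase identity behind Girardeau's Bose–Fermi map for two insertion points.
[cite: ForresterEtAl2003, §2.1.1] -/
theorem eL_factor_identity (L a b x : ℝ) :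
    (eL L x - eL L a) * conj (eL L x - eL L b) =
      4 * cexp (↑(π * (a - b) / L) * I) *
        ((Real.sin (π * (a - x) / L) : ℂ) * (Real.sin (π * (b - x) / L) : ℂ)) := by
  have ha : eL L x - eL L a = -(eL L a - eL L x) := by ring
  have hb : eL L x - eL L b = -(eL L b - eL L x) := by ring
  rw [ha, hb, map_neg, neg_mul_neg, eL_sub_eL, eL_sub_eL]
  simp only [map_mul, ← Complex.exp_conj, Complex.conj_ofReal, Complex.conj_I, map_ofNat]
  have h3 : cexp (↑(π * (a + x) / L) * I) * cexp (↑(π * (b + x) / L) * -I) =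
      cexp (↑(π * (a - b) / L) * I) := by
    rw [← Complex.exp_add]; congr 1; push_cast; ring
  set s1 := (Real.sin (π * (a - x) / L) : ℂ)
  set s2 := (Real.sin (π * (b - x) / L) : ℂ)
  linear_combination (2 * I * s1) * (2 * -I * s2) * h3 +
    (-4 * cexp (↑(π * (a - b) / L) * I) * s1 * s2) * Complex.I_sq

/-- The Girardeau state is the modulus of the Vandermonde (free-fermion Slater) determinant in
the variables `e(x_j)`. [cite: ForresterEtAl2003, §2.1.1] -/
theorem girardeauState_eq_norm_det (N : ℕ) (L : ℝ) (Y : Fin N → ℝ) :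
    girardeauState N L Y =
      (Real.sqrt (N.factorial * L ^ N))⁻¹ * ‖det (vandermonde fun j => eL L (Y j))‖ := by
  unfold girardeauState
  congr 1
  rw [det_vandermonde, norm_prod]
  refine Finset.prod_congr rfl fun j _ => ?_
  rw [norm_prod, Finset.filter_lt_eq_Ioi]
  refine Finset.prod_congr rfl fun k _ => ?_
  rw [norm_eL_sub_eL]

/-- Splitting off the first point of a Vandermonde determinant. [folklore] -/
theorem det_vandermonde_cons {R : Type*} [CommRing R] {n : ℕ} (a : R) (v : Fin n → R) :
    det (vandermonde (Fin.cons a v : Fin (n + 1) → R)) =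
      (∏ j, (v j - a)) * det (vandermonde v) := by
  rw [det_vandermonde, det_vandermonde, Fin.prod_univ_succ]
  congr 1
  · rw [Fin.prod_Ioi_zero]; simp
  · refine Finset.prod_congr rfl fun i _ => ?_
    rw [Fin.prod_Ioi_succ]; simp

/-- The modulus of the Vandermonde determinant does not depend on where the extra point is
inserted. [folklore] -/
theorem norm_det_vandermonde_snoc {n : ℕ} (L : ℝ) (X : Fin n → ℝ) (a : ℝ) :
    ‖det (vandermonde fun j => eL L ((Fin.snoc X a : Fin (n + 1) → ℝ) j))‖ =
      ‖det (vandermonde fun j => eL L ((Fin.cons a X : Fin (n + 1) → ℝ) j))‖ := by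
  rw [Fin.snoc_eq_cons_rotate]
  have : (vandermonde fun j => eL L ((Fin.cons a X : Fin (n + 1) → ℝ) (finRotate (n + 1) j))) =
      (vandermonde fun j => eL L ((Fin.cons a X : Fin (n + 1) → ℝ) j)).submatrix
        (finRotate (n + 1)) id := by
    ext i j; simp [vandermonde_apply]
  rw [this, det_permute, norm_mul]
  simp

/-- The sign function `s = 1 - 2·𝟙_{(min a b, max a b)}`. [folklore] -/
def sgnFun (a b x : ℝ) : ℝ := if x ∈ Set.Ioo (min a b) (max a b) then -1 else 1

/-- `s(x)² = 1`. [folklore] -/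
theorem sgnFun_mul_self (a b x : ℝ) : sgnFun a b x * sgnFun a b x = 1 := by
  unfold sgnFun; split_ifs <;> norm_num

/-- `|s(x)| = 1`. [folklore] -/
theorem abs_sgnFun (a b x : ℝ) : |sgnFun a b x| = 1 := by
  unfold sgnFun; split_ifs <;> norm_num

/-- `s` is symmetric in `a, b`. [folklore] -/
theorem sgnFun_comm (a b x : ℝ) : sgnFun a b x = sgnFun b a x := by
  unfold sgnFun; rw [min_comm, max_comm]

/-- Sign lemma: for `a, b, x ∈ [0, L]`, `s(x) sin(π(a-x)/L) sin(π(b-x)/L) ≥ 0`. [folklore] -/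
theorem sgnFun_mul_sin_mul_sin_nonneg {L a b x : ℝ} (hL : 0 < L)
    (ha : a ∈ Set.Icc 0 L) (hb : b ∈ Set.Icc 0 L) (hx : x ∈ Set.Icc 0 L) :
    0 ≤ sgnFun a b x * (Real.sin (π * (a - x) / L) * Real.sin (π * (b - x) / L)) := by
  -- elementary facts about signs of `sin(π t / L)` for `t ∈ [-L, L]`
  have hpos : ∀ t : ℝ, 0 ≤ t → t ≤ L → 0 ≤ Real.sin (π * t / L) := by
    intro t h0 h1
    apply Real.sin_nonneg_of_nonneg_of_le_pi
    · positivity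
    · rw [div_le_iff₀ hL]; nlinarith [Real.pi_pos]
  have hneg : ∀ t : ℝ, t ≤ 0 → -L ≤ t → Real.sin (π * t / L) ≤ 0 := by
    intro t h0 h1
    apply Real.sin_nonpos_of_nonpos_of_neg_pi_le
    · rw [div_nonpos_iff]; right; constructor
      · nlinarith [Real.pi_pos]
      · exact hL.le
    · rw [le_div_iff₀ hL]; nlinarith [Real.pi_pos]
  wlog hab : a ≤ b generalizing a b
  · rw [sgnFun_comm, mul_comm (Real.sin _) (Real.sin _)]
    exact this hb ha (le_of_not_ge hab)
  unfold sgnFun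
  rw [min_eq_left hab, max_eq_right hab]
  obtain ⟨ha0, haL⟩ := ha
  obtain ⟨hb0, hbL⟩ := hb
  obtain ⟨hx0, hxL⟩ := hx
  split_ifs with h
  · obtain ⟨h1, h2⟩ := h
    have e1 : Real.sin (π * (a - x) / L) ≤ 0 := hneg _ (by linarith) (by linarith)
    have e2 : 0 ≤ Real.sin (π * (b - x) / L) := hpos _ (by linarith) (by linarith)
    nlinarith [mul_nonpos_iff.mpr (Or.inr ⟨e1, e2⟩)]
  · rw [one_mul]
    rw [Set.mem_Ioo, not_and_or, not_lt, not_lt] at h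
    rcases h with h | h
    · exact mul_nonneg (hpos _ (by linarith) (by linarith)) (hpos _ (by linarith) (by linarith))
    · exact mul_nonneg_of_nonpos_of_nonpos (hneg _ (by linarith) (by linarith))
        (hneg _ (by linarith) (by linarith))

/-- On `[0, L]`, multiplying by `s(x)` removes the absolute values:
`s(x) sin(π(a−x)/L) sin(π(b−x)/L) = |sin(π(a−x)/L) sin(π(b−x)/L)|` (Girardeau's Bose–Fermi map
for two insertion points). [cite: ForresterEtAl2003, §2.1.1] -/
theorem sgnFun_mul_eq_abs {L a b x : ℝ} (hL : 0 < L)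
    (ha : a ∈ Set.Icc 0 L) (hb : b ∈ Set.Icc 0 L) (hx : x ∈ Set.Icc 0 L) :
    sgnFun a b x * (Real.sin (π * (a - x) / L) * Real.sin (π * (b - x) / L)) =
      |Real.sin (π * (a - x) / L) * Real.sin (π * (b - x) / L)| := by
  have h := sgnFun_mul_sin_mul_sin_nonneg hL ha hb hx
  rw [← abs_of_nonneg h, abs_mul, abs_sgnFun, one_mul]


/-! ### Part B: Andréief's identity -/

section Andreief
variable {𝕜 : Type*} [RCLike 𝕜]



/-- Leibniz expansion in the form `det [F t (X r)]_{r,t} = ∑_σ sign σ ∏_i F (σ i) (X i)`.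
[folklore] -/
theorem det_of_eval_eq_sum_perm {n : ℕ} {α : Type*} (F : Fin n → α → 𝕜) (X : Fin n → α) :
    det (of fun r t => F t (X r)) =
      ∑ σ : Perm (Fin n), ((Perm.sign σ : ℤ) : 𝕜) * ∏ i, F (σ i) (X i) := by
  rw [← det_transpose, det_apply']
  rfl

/-- Pointwise expansion of `det[F_t(x_r)] det[G_t(x_r)]` as a double sum over permutations.
[cite: ForresterEtAl2003, §2.1.2 (penultimate Heine identity step)] -/
theorem det_mul_det_eq_sum_perm {n : ℕ} {α : Type*} (F G : Fin n → α → 𝕜) (X : Fin n → α) :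
    det (of fun r t => F t (X r)) * det (of fun r t => G t (X r)) =
      ∑ σ : Perm (Fin n), ∑ τ : Perm (Fin n),
        (((Perm.sign σ : ℤ) : 𝕜) * ((Perm.sign τ : ℤ) : 𝕜)) *
          ∏ i, (F (σ i) (X i) * G (τ i) (X i)) := by
  rw [det_of_eval_eq_sum_perm, det_of_eval_eq_sum_perm, Finset.sum_mul_sum]
  refine Finset.sum_congr rfl fun σ _ => Finset.sum_congr rfl fun τ _ => ?_
  rw [Finset.prod_mul_distrib]; ring

/-- Integrability of one term of the Leibniz double expansion. [folklore] -/
theorem integrable_sign_mul_prod {n : ℕ} {α : Type*} [MeasurableSpace α] (μ : Measure α)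
    [SigmaFinite μ] (F G : Fin n → α → 𝕜)
    (hFG : ∀ t t', Integrable (fun x => F t x * G t' x) μ) (σ τ : Perm (Fin n)) :
    Integrable (fun X : Fin n → α => (((Perm.sign σ : ℤ) : 𝕜) * ((Perm.sign τ : ℤ) : 𝕜)) *
        ∏ i, (F (σ i) (X i) * G (τ i) (X i))) (Measure.pi fun _ => μ) := by
  refine Integrable.const_mul ?_ _
  exact Integrable.fintype_prod (f := fun i x => F (σ i) x * G (τ i) x) fun i => hFG _ _

/-- The product of the two "Slater determinants" is integrable on the product space. [folklore] -/
theorem integrable_det_mul_det {n : ℕ} {α : Type*} [MeasurableSpace α] (μ : Measure α)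
    [SigmaFinite μ] (F G : Fin n → α → 𝕜)
    (hFG : ∀ t t', Integrable (fun x => F t x * G t' x) μ) :
    Integrable (fun X : Fin n → α =>
      det (of fun r t => F t (X r)) * det (of fun r t => G t (X r))) (Measure.pi fun _ => μ) := by
  simp_rw [det_mul_det_eq_sum_perm]
  exact integrable_finsetSum _ fun σ _ => integrable_finsetSum _ fun τ _ =>
    integrable_sign_mul_prod μ F G hFG σ τ

/-- **Andréief's integration identity** (continuous Cauchy–Binet):
`∫ det[F_t(x_r)] det[G_t(x_r)] dμ^{⊗n} = n! · det[∫ F_t G_{t'} dμ]`.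
(two-function form of the Heine identity behind the Toeplitz representation)
[cite: ForresterEtAl2003, §2.1.2] -/
theorem integral_det_mul_det {n : ℕ} {α : Type*} [MeasurableSpace α] (μ : Measure α)
    [SigmaFinite μ] (F G : Fin n → α → 𝕜)
    (hFG : ∀ t t', Integrable (fun x => F t x * G t' x) μ) :
    ∫ X : Fin n → α, det (of fun r t => F t (X r)) * det (of fun r t => G t (X r))
        ∂(Measure.pi fun _ => μ) =
      (n.factorial : 𝕜) * det (of fun t t' => ∫ x, F t x * G t' x ∂μ) := by
  set A : Matrix (Fin n) (Fin n) 𝕜 := of fun t t' => ∫ x, F t x * G t' x ∂μ with hA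
  simp_rw [det_mul_det_eq_sum_perm]
  have hint := integrable_sign_mul_prod μ F G hFG
  rw [integral_finsetSum _ fun σ _ => integrable_finsetSum _ fun τ _ => hint σ τ]
  simp_rw [integral_finsetSum _ fun τ _ => hint _ τ, integral_const_mul]
  have hprod : ∀ σ τ : Perm (Fin n),
      ∫ X : Fin n → α, ∏ i, (F (σ i) (X i) * G (τ i) (X i)) ∂(Measure.pi fun _ => μ) =
        ∏ i, A (σ i) (τ i) := by
    intro σ τ
    rw [integral_fintype_prod_eq_prod (f := fun i x => F (σ i) x * G (τ i) x)]
    simp [hA]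
  simp_rw [hprod]
  -- now a pure combinatorial identity
  have hinner : ∀ σ : Perm (Fin n),
      ∑ τ : Perm (Fin n), (((Perm.sign σ : ℤ) : 𝕜) * ((Perm.sign τ : ℤ) : 𝕜)) *
        ∏ i, A (σ i) (τ i) = det A := by
    intro σ
    rw [det_apply']
    -- reindex `τ ↦ σ * τ⁻¹`
    refine Fintype.sum_equiv ((Equiv.inv (Perm (Fin n))).trans (Equiv.mulLeft σ)) _ _ fun τ => ?_
    simp only [Equiv.trans_apply, Equiv.inv_apply, Equiv.coe_mulLeft, Perm.sign_mul,
      Perm.sign_inv, Units.val_mul, Int.cast_mul]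
    have hp : ∏ i, A (σ i) (τ i) = ∏ i, A ((σ * τ⁻¹) i) i := by
      refine Fintype.prod_equiv τ _ _ fun i => ?_
      simp [Perm.mul_apply]
    rw [hp]
  simp_rw [hinner, Finset.sum_const, Finset.card_univ, Fintype.card_perm, Fintype.card_fin,
    nsmul_eq_mul]

end Andreief


/-! ### Part C: Lenard's adjugate formula for the sign-twisted Slater overlap -/

section Lenard

variable {n : ℕ}

/-- Plane-wave power vector `u_p = e(a)^p`. [folklore] -/
def uVec (n : ℕ) (L a : ℝ) : Fin (n + 1) → ℂ := fun p => eL L a ^ (p : ℕ)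

/-- The sign-twisted Gram matrix `G_{kl} = ∫ s(x) e(x)^k conj(e(x))^l dμ`. [folklore] -/
def gramS (n : ℕ) (μ : Measure ℝ) (L a b : ℝ) : Matrix (Fin (n + 1)) (Fin (n + 1)) ℂ :=
  of fun k l => ∫ x, (sgnFun a b x : ℂ) * eL L x ^ (k : ℕ) * conj (eL L x) ^ (l : ℕ) ∂μ

/-- The sign function is measurable. [folklore] -/
theorem measurable_sgnFun (a b : ℝ) : Measurable (sgnFun a b) := by
  unfold sgnFun
  exact Measurable.ite measurableSet_Ioo measurable_const measurable_const

/-- Plane waves are continuous. [folklore] -/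
theorem continuous_eL (L : ℝ) : Continuous (eL L) := by
  unfold eL; fun_prop

/-- Laplace expansion of the Vandermonde determinant along the inserted point. [folklore] -/
theorem det_vandermonde_cons_eq_sum (L a : ℝ) (X : Fin n → ℝ) :
    det (vandermonde fun j => eL L ((Fin.cons a X : Fin (n + 1) → ℝ) j)) =
      ∑ p : Fin (n + 1), ((-1) ^ (p : ℕ) * eL L a ^ (p : ℕ)) *
        det (of fun r t => eL L (X r) ^ ((p.succAbove t : Fin (n + 1)) : ℕ)) := by
  rw [det_succ_row_zero]
  refine Finset.sum_congr rfl fun p _ => ?_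
  have h0 : (vandermonde fun j => eL L ((Fin.cons a X : Fin (n + 1) → ℝ) j)) 0 p =
      eL L a ^ (p : ℕ) := by
    simp [vandermonde_apply]
  have h1 : (vandermonde fun j => eL L ((Fin.cons a X : Fin (n + 1) → ℝ) j)).submatrix
      Fin.succ p.succAbove = of fun r t => eL L (X r) ^ ((p.succAbove t : Fin (n + 1)) : ℕ) := by
    ext r t; simp [vandermonde_apply]
  rw [h0, h1, mul_assoc]

/-- The twisted Gram integrands are bounded by `1`, hence integrable on a finite measure.
[folklore] -/
theorem integrable_sgn_pow_pow (μ : Measure ℝ) [IsFiniteMeasure μ] (L a b : ℝ) (k l : ℕ) :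
    Integrable (fun x => (sgnFun a b x : ℂ) * eL L x ^ k * conj (eL L x) ^ l) μ := by
  refine Integrable.mono' (integrable_const (1 : ℝ)) ?_ (Filter.Eventually.of_forall fun x => ?_)
  · refine Measurable.aestronglyMeasurable ?_
    refine ((Complex.measurable_ofReal.comp (measurable_sgnFun a b)).mul
      ((continuous_eL L).measurable.pow_const k)).mul ?_
    exact ((Complex.continuous_conj.measurable.comp (continuous_eL L).measurable).pow_const l)
  · rw [norm_mul, norm_mul, norm_pow, norm_pow, Complex.norm_conj, norm_eL, one_pow, one_pow,
      mul_one, mul_one, Complex.norm_real, Real.norm_eq_abs, abs_sgnFun]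

/-- **Lenard's formula (integrated form).** The sign-twisted overlap of the two Slater
determinants is `n!` times the bilinear form of the adjugate of the twisted Gram matrix.
(cofactor/bordered-determinant form of Lenard's Toeplitz formula)
[cite: ForresterEtAl2003, §2.1.2] -/
theorem integral_sgn_det_det (μ : Measure ℝ) [IsFiniteMeasure μ] (L a b : ℝ) :
    ∫ X : Fin n → ℝ, (∏ j, (sgnFun a b (X j) : ℂ)) *
        (det (vandermonde fun j => eL L ((Fin.cons a X : Fin (n + 1) → ℝ) j)) *
          conj (det (vandermonde fun j => eL L ((Fin.cons b X : Fin (n + 1) → ℝ) j))))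
        ∂(Measure.pi fun _ => μ) =
      (n.factorial : ℂ) * (star (uVec n L b) ⬝ᵥ ((gramS n μ L a b).adjugate *ᵥ uVec n L a)) := by
  -- Step 1: pointwise expansion of the integrand as a double sum over (p, q).
  set F : Fin (n + 1) → Fin n → ℝ → ℂ :=
    fun p t x => (sgnFun a b x : ℂ) * eL L x ^ ((p.succAbove t : Fin (n + 1)) : ℕ) with hF
  set G : Fin (n + 1) → Fin n → ℝ → ℂ :=
    fun q t x => conj (eL L x) ^ ((q.succAbove t : Fin (n + 1)) : ℕ) with hG
  have hexp : ∀ X : Fin n → ℝ,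
      (∏ j, (sgnFun a b (X j) : ℂ)) *
        (det (vandermonde fun j => eL L ((Fin.cons a X : Fin (n + 1) → ℝ) j)) *
          conj (det (vandermonde fun j => eL L ((Fin.cons b X : Fin (n + 1) → ℝ) j)))) =
      ∑ p : Fin (n + 1), ∑ q : Fin (n + 1),
        (((-1) ^ (p : ℕ) * eL L a ^ (p : ℕ)) * ((-1) ^ (q : ℕ) * conj (eL L b) ^ (q : ℕ))) *
          (det (of fun r t => F p t (X r)) * det (of fun r t => G q t (X r))) := by
    intro X
    rw [det_vandermonde_cons_eq_sum, det_vandermonde_cons_eq_sum, map_sum, Finset.sum_mul_sum,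
      Finset.mul_sum]
    refine Finset.sum_congr rfl fun p _ => ?_
    rw [Finset.mul_sum]
    refine Finset.sum_congr rfl fun q _ => ?_
    have hFdet : (∏ j, (sgnFun a b (X j) : ℂ)) *
        det (of fun r t => eL L (X r) ^ ((p.succAbove t : Fin (n + 1)) : ℕ)) =
        det (of fun r t => F p t (X r)) := by
      rw [hF, ← det_mul_column]
      rfl
    have hGdet : conj (det (of fun r t => eL L (X r) ^ ((q.succAbove t : Fin (n + 1)) : ℕ))) =
        det (of fun r t => G q t (X r)) := by
      rw [hG, RingHom.map_det]
      congr 1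
      ext r t
      simp [map_pow]
    rw [map_mul, map_mul, map_pow, map_pow, map_neg, map_one, hGdet, ← hFdet]
    ring
  simp_rw [hexp]
  -- Step 2: integrate term by term using Andréief.
  have hFG : ∀ p q : Fin (n + 1), ∀ t t' : Fin n,
      Integrable (fun x => F p t x * G q t' x) μ := by
    intro p q t t'
    simpa [hF, hG, mul_assoc] using integrable_sgn_pow_pow μ L a b _ _
  have hint : ∀ p q : Fin (n + 1), Integrable (fun X : Fin n → ℝ =>
      (((-1) ^ (p : ℕ) * eL L a ^ (p : ℕ)) * ((-1) ^ (q : ℕ) * conj (eL L b) ^ (q : ℕ))) *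
        (det (of fun r t => F p t (X r)) * det (of fun r t => G q t (X r))))
      (Measure.pi fun _ => μ) := fun p q =>
    (integrable_det_mul_det μ (F p) (G q) (hFG p q)).const_mul _
  rw [integral_finsetSum _ fun p _ => integrable_finsetSum _ fun q _ => hint p q]
  simp_rw [integral_finsetSum _ fun q _ => hint _ q, integral_const_mul,
    integral_det_mul_det μ (F _) (G _) (hFG _ _)]
  -- Step 3: identify the cofactors.
  have hsub : ∀ p q : Fin (n + 1),
      (of fun t t' => ∫ x, F p t x * G q t' x ∂μ) =
        (gramS n μ L a b).submatrix p.succAbove q.succAbove := by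
    intro p q
    ext t t'
    simp only [gramS, of_apply, submatrix_apply, hF, hG, mul_assoc]
  simp_rw [hsub]
  have hadj : ∀ p q : Fin (n + 1),
      (gramS n μ L a b).adjugate q p =
        (-1) ^ ((p : ℕ) + (q : ℕ)) * det ((gramS n μ L a b).submatrix p.succAbove q.succAbove) :=
    fun p q => adjugate_fin_succ_eq_det_submatrix _ _ _
  -- Step 4: rewrite the bilinear form.
  simp only [dotProduct, mulVec, uVec, Pi.star_apply, star_pow, Complex.star_def, hadj,
    Finset.mul_sum]
  rw [Finset.sum_comm]
  refine Finset.sum_congr rfl fun q _ => Finset.sum_congr rfl fun p _ => ?_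
  rw [pow_add]
  ring

end Lenard


/-! ### Part D: the density matrix as an adjugate bilinear form -/

section Density

variable {n : ℕ} {L a b : ℝ}

/-- `z · conj z = |z|²` as a complex number. [folklore] -/
theorem mul_conj_eq_norm_sq (z : ℂ) : z * conj z = ((‖z‖ ^ 2 : ℝ) : ℂ) := by
  rw [Complex.mul_conj, Complex.normSq_eq_norm_sq]

/-- `e ∘ cons a X = cons (e a) (e ∘ X)`. [folklore] -/
theorem eL_comp_cons (L a : ℝ) (X : Fin n → ℝ) :
    (fun j => eL L ((Fin.cons a X : Fin (n + 1) → ℝ) j)) =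
      Fin.cons (eL L a) fun j => eL L (X j) := by
  ext j
  refine Fin.cases ?_ (fun i => ?_) j <;> simp

/-- The pointwise Bose–Fermi identity: the sign-twisted overlap of the two Slater determinants
is a fixed phase times `(N! L^N) ψ(X, a) ψ(X, b)`. [cite: ForresterEtAl2003, §2.1.1] -/
theorem sgn_det_det_eq_girardeau (hL : 0 < L) (ha : a ∈ Set.Icc 0 L) (hb : b ∈ Set.Icc 0 L)
    (X : Fin n → ℝ) (hX : ∀ j, X j ∈ Set.Icc 0 L) :
    (∏ j, (sgnFun a b (X j) : ℂ)) *
        (det (vandermonde fun j => eL L ((Fin.cons a X : Fin (n + 1) → ℝ) j)) *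
          conj (det (vandermonde fun j => eL L ((Fin.cons b X : Fin (n + 1) → ℝ) j)))) =
      cexp (↑(π * (a - b) / L) * I) ^ n * ((((n + 1).factorial : ℝ) * L ^ (n + 1) : ℝ) : ℂ) *
        ((girardeauState (n + 1) L (Fin.snoc X a) * girardeauState (n + 1) L (Fin.snoc X b) :
          ℝ) : ℂ) := by
  -- notation
  set Φ : ℂ := cexp (↑(π * (a - b) / L) * I) with hΦ
  set A : ℂ := det (vandermonde fun j => eL L (X j)) with hA
  set sa : Fin n → ℝ := fun j => Real.sin (π * (a - X j) / L) with hsa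
  set sb : Fin n → ℝ := fun j => Real.sin (π * (b - X j) / L) with hsb
  set Pa : ℂ := ∏ j, (eL L (X j) - eL L a) with hPa
  set Pb : ℂ := ∏ j, (eL L (X j) - eL L b) with hPb
  have hΦn : ‖Φ‖ = 1 := norm_exp_ofReal_mul_I _
  -- the cons-Vandermonde determinants
  have hdetA : det (vandermonde fun j => eL L ((Fin.cons a X : Fin (n + 1) → ℝ) j)) = Pa * A := by
    rw [eL_comp_cons, det_vandermonde_cons]
  have hdetB : det (vandermonde fun j => eL L ((Fin.cons b X : Fin (n + 1) → ℝ) j)) = Pb * A := by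
    rw [eL_comp_cons, det_vandermonde_cons]
  -- the product of the two one-particle factors
  have hPP : Pa * conj Pb = (4 * Φ) ^ n * ∏ j, ((sa j : ℂ) * (sb j : ℂ)) := by
    rw [hPa, hPb, map_prod, ← Finset.prod_mul_distrib]
    simp_rw [eL_factor_identity]
    rw [Finset.prod_mul_distrib, Finset.prod_const, Finset.card_univ, Fintype.card_fin]
  have hPPnorm : ‖Pa‖ * ‖Pb‖ = 4 ^ n * ∏ j, |sa j * sb j| := by
    rw [← Complex.norm_conj Pb, ← norm_mul, hPP, norm_mul, norm_pow, norm_mul, hΦn, mul_one,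
      Complex.norm_ofNat, norm_prod]
    congr 1
    refine Finset.prod_congr rfl fun j _ => ?_
    rw [← Complex.ofReal_mul, Complex.norm_real, Real.norm_eq_abs]
  -- the Girardeau states
  have hC2 : (0 : ℝ) < ((n + 1).factorial : ℝ) * L ^ (n + 1) := by positivity
  have hgs : ∀ c : ℝ, ∀ P : ℂ,
      det (vandermonde fun j => eL L ((Fin.cons c X : Fin (n + 1) → ℝ) j)) = P * A →
      girardeauState (n + 1) L (Fin.snoc X c) =
        (Real.sqrt (((n + 1).factorial : ℝ) * L ^ (n + 1)))⁻¹ * (‖P‖ * ‖A‖) := by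
    intro c P h
    rw [girardeauState_eq_norm_det, norm_det_vandermonde_snoc, h, norm_mul]
  have hRHS : (((n + 1).factorial : ℝ) * L ^ (n + 1)) *
      (girardeauState (n + 1) L (Fin.snoc X a) * girardeauState (n + 1) L (Fin.snoc X b)) =
      (4 ^ n * ∏ j, |sa j * sb j|) * ‖A‖ ^ 2 := by
    rw [hgs a Pa hdetA, hgs b Pb hdetB, ← hPPnorm]
    set C2 : ℝ := ((n + 1).factorial : ℝ) * L ^ (n + 1)
    have hs : (Real.sqrt C2)⁻¹ * (Real.sqrt C2)⁻¹ = C2⁻¹ := by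
      rw [← mul_inv, Real.mul_self_sqrt hC2.le]
    have hC2' : C2 ≠ 0 := hC2.ne'
    calc C2 * ((Real.sqrt C2)⁻¹ * (‖Pa‖ * ‖A‖) * ((Real.sqrt C2)⁻¹ * (‖Pb‖ * ‖A‖)))
        = C2 * ((Real.sqrt C2)⁻¹ * (Real.sqrt C2)⁻¹) * (‖Pa‖ * ‖Pb‖) * ‖A‖ ^ 2 := by ring
      _ = ‖Pa‖ * ‖Pb‖ * ‖A‖ ^ 2 := by rw [hs, mul_inv_cancel₀ hC2', one_mul]
  -- the sign identity
  have hsign : (∏ j, (sgnFun a b (X j) : ℂ)) * ∏ j, ((sa j : ℂ) * (sb j : ℂ)) =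
      ((∏ j, |sa j * sb j| : ℝ) : ℂ) := by
    rw [← Finset.prod_mul_distrib, Complex.ofReal_prod]
    refine Finset.prod_congr rfl fun j _ => ?_
    rw [← sgnFun_mul_eq_abs hL ha hb (hX j)]
    push_cast
    simp [hsa, hsb]
  -- assemble
  rw [mul_assoc, ← Complex.ofReal_mul, hRHS, hdetA, hdetB, map_mul]
  calc (∏ j, (sgnFun a b (X j) : ℂ)) * (Pa * A * (conj Pb * conj A))
      = ((∏ j, (sgnFun a b (X j) : ℂ)) * (Pa * conj Pb)) * (A * conj A) := by ring
    _ = Φ ^ n * 4 ^ n * ((∏ j, (sgnFun a b (X j) : ℂ)) * ∏ j, ((sa j : ℂ) * (sb j : ℂ))) *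
          (A * conj A) := by rw [hPP, mul_pow]; ring
    _ = Φ ^ n * 4 ^ n * ((∏ j, |sa j * sb j| : ℝ) : ℂ) * ((‖A‖ ^ 2 : ℝ) : ℂ) := by
          rw [hsign, mul_conj_eq_norm_sq]
    _ = Φ ^ n * (((4 ^ n * ∏ j, |sa j * sb j|) * ‖A‖ ^ 2 : ℝ) : ℂ) := by push_cast; ring

end Density


/-! ### Part E: the twisted Gram matrix in closed form -/

section Gram

variable {n : ℕ} {L a b : ℝ}

/-- The integer plane wave `ez L m x = exp(2π i m x / L)`. [folklore] -/
def ez (L : ℝ) (m : ℤ) (x : ℝ) : ℂ := cexp (↑(2 * π * m * x / L) * I)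

/-- Integer plane waves are continuous. [folklore] -/
theorem continuous_ez (L : ℝ) (m : ℤ) : Continuous (ez L m) := by
  unfold ez; fun_prop

/-- Integer plane waves have unit modulus. [folklore] -/
theorem norm_ez (L : ℝ) (m : ℤ) (x : ℝ) : ‖ez L m x‖ = 1 := by
  unfold ez; exact norm_exp_ofReal_mul_I _

/-- Fourier coefficient of the indicator of the open interval between `a` and `b`:
`q(m) = L⁻¹ ∫_{(min a b, max a b)} e^{2π i m x / L} dx`. [folklore] -/
def qCoeff (L a b : ℝ) (m : ℤ) : ℂ :=
  (L : ℂ)⁻¹ * ∫ x in Set.Ioo (min a b) (max a b), ez L m x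

/-- Lenard's matrix `M = 1 - 2Q` with `Q_{kl} = q(k - l)` (the compression of the projection
onto the arc between `a` and `b` to the span of the first `n + 1` plane waves). [folklore] -/
def lenardMatrix (n : ℕ) (L a b : ℝ) : Matrix (Fin (n + 1)) (Fin (n + 1)) ℂ :=
  of fun k l => (if k = l then (1 : ℂ) else 0) - 2 * qCoeff L a b ((k : ℤ) - (l : ℤ))

/-- `e(x)^k · conj(e(x))^l = e^{2πi(k−l)x/L}`. [folklore] -/
theorem eL_pow_mul_conj_pow (L x : ℝ) (k l : ℕ) :
    eL L x ^ k * conj (eL L x) ^ l = ez L ((k : ℤ) - (l : ℤ)) x := by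
  unfold eL ez
  rw [← Complex.exp_conj, ← Complex.exp_nat_mul, ← Complex.exp_nat_mul, ← Complex.exp_add]
  congr 1
  simp only [map_mul, Complex.conj_ofReal, Complex.conj_I]
  push_cast
  ring

/-- Orthogonality of the plane waves on `[0, L]`: `∫₀ᴸ e^{2πimx/L} dx = L δ_{m,0}`. [folklore] -/
theorem integral_ez_Icc (hL : 0 < L) (m : ℤ) :
    ∫ x in Set.Icc 0 L, ez L m x = if m = 0 then (L : ℂ) else 0 := by
  rw [integral_Icc_eq_integral_Ioc, ← intervalIntegral.integral_of_le hL.le]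
  split_ifs with hm
  · simp [ez, hm]
  · set c : ℂ := ↑(2 * π * m / L) * I with hc
    have hc0 : c ≠ 0 := by
      refine mul_ne_zero ?_ Complex.I_ne_zero
      exact_mod_cast (by positivity : (2 * π * m / L : ℝ) ≠ 0)
    have hfun : (fun x : ℝ => ez L m x) = fun x : ℝ => cexp (c * x) := by
      ext x; unfold ez; congr 1; rw [hc]; push_cast; ring
    rw [hfun, integral_exp_mul_complex hc0]
    have hL0 : (L : ℂ) ≠ 0 := by exact_mod_cast hL.ne'
    have h1 : c * (L : ℝ) = (m : ℂ) * (2 * π * I) := by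
      rw [hc]; push_cast; field_simp
    rw [h1, Complex.exp_int_mul_two_pi_mul_I]
    simp

/-- `s = 1 − 2·𝟙_{(min a b, max a b)}`. [folklore] -/
theorem sgnFun_eq_indicator (a b x : ℝ) :
    (sgnFun a b x : ℂ) =
      1 - 2 * Set.indicator (Set.Ioo (min a b) (max a b)) (fun _ => (1 : ℂ)) x := by
  unfold sgnFun
  by_cases hx : x ∈ Set.Ioo (min a b) (max a b)
  · simp [hx]; norm_num
  · simp [hx]

/-- The open arc between two points of `[0, L]` lies in `[0, L]`. [folklore] -/
theorem Ioo_subset_Icc_of_mem (ha : a ∈ Set.Icc 0 L) (hb : b ∈ Set.Icc 0 L) :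
    Set.Ioo (min a b) (max a b) ⊆ Set.Icc 0 L := by
  intro x hx
  simp only [Set.mem_Ioo, Set.mem_Icc, min_lt_iff, lt_max_iff] at hx ⊢
  obtain ⟨h1, h2⟩ := hx
  constructor
  · rcases h1 with h1 | h1 <;> linarith [ha.1, hb.1]
  · rcases h2 with h2 | h2 <;> linarith [ha.2, hb.2]

/-- Entries of the twisted Gram matrix over `[0, L]`. [folklore] -/
theorem gramS_entry (hL : 0 < L) (ha : a ∈ Set.Icc 0 L) (hb : b ∈ Set.Icc 0 L) (k l : ℕ) :
    ∫ x in Set.Icc 0 L, (sgnFun a b x : ℂ) * eL L x ^ k * conj (eL L x) ^ l =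
      L * ((if (k : ℤ) = l then (1 : ℂ) else 0) - 2 * qCoeff L a b ((k : ℤ) - (l : ℤ))) := by
  set m : ℤ := (k : ℤ) - (l : ℤ) with hm
  have hint : IntegrableOn (ez L m) (Set.Icc 0 L) := (continuous_ez L m).integrableOn_Icc
  have hrew : ∀ x, (sgnFun a b x : ℂ) * eL L x ^ k * conj (eL L x) ^ l =
      ez L m x - 2 * (Set.Ioo (min a b) (max a b)).indicator (ez L m) x := by
    intro x
    rw [mul_assoc, eL_pow_mul_conj_pow, sgnFun_eq_indicator, ← hm]
    by_cases hx : x ∈ Set.Ioo (min a b) (max a b)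
    · rw [Set.indicator_of_mem hx, Set.indicator_of_mem hx]; ring
    · rw [Set.indicator_of_notMem hx, Set.indicator_of_notMem hx]; ring
  simp_rw [hrew]
  rw [integral_sub hint ((hint.indicator measurableSet_Ioo).const_mul _), integral_const_mul,
    setIntegral_indicator measurableSet_Ioo,
    Set.inter_eq_self_of_subset_right (Ioo_subset_Icc_of_mem ha hb), integral_ez_Icc hL]
  have hq : ∫ x in Set.Ioo (min a b) (max a b), ez L m x = L * qCoeff L a b m := by
    unfold qCoeff
    rw [← mul_assoc, mul_inv_cancel₀ (by exact_mod_cast hL.ne'), one_mul]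
  rw [hq]
  have hm0 : m = 0 ↔ (k : ℤ) = l := by rw [hm, sub_eq_zero]
  by_cases hkl : (k : ℤ) = l
  · rw [if_pos (hm0.mpr hkl), if_pos hkl]; ring
  · rw [if_neg (mt hm0.mp hkl), if_neg hkl]; ring

/-- The twisted Gram matrix over `[0, L]` is `L · (1 − 2Q)`. [folklore] -/
theorem gramS_eq_smul (hL : 0 < L) (ha : a ∈ Set.Icc 0 L) (hb : b ∈ Set.Icc 0 L) :
    gramS n (volume.restrict (Set.Icc 0 L)) L a b = (L : ℂ) • lenardMatrix n L a b := by
  ext k l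
  simp only [gramS, lenardMatrix, of_apply, Matrix.smul_apply, smul_eq_mul]
  rw [gramS_entry hL ha hb]
  congr 3
  simp [Fin.ext_iff]

/-- **Lenard's formula.** For `a, b ∈ [0, L]`,
`ρ_{n+1}(a, b) = L⁻¹ e^{-iπn(a-b)/L} ⟨u(b), adj(M) u(a)⟩`.
(equivalent to the printed Toeplitz form `ϱ_N = det[γ_{j-k}]`; agrees with the printed `ϱ₂`)
[cite: ForresterEtAl2003, §2.1.2] -/
theorem density_eq_adjugate (hL : 0 < L) (ha : a ∈ Set.Icc 0 L) (hb : b ∈ Set.Icc 0 L) :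
    (girardeauDensityMatrix (n + 1) L a b : ℂ) =
      (L : ℂ)⁻¹ * ((cexp (↑(π * (a - b) / L) * I) ^ n)⁻¹ *
        (star (uVec n L b) ⬝ᵥ ((lenardMatrix n L a b).adjugate *ᵥ uVec n L a))) := by
  have hdef : girardeauDensityMatrix (n + 1) L a b = (n + 1 : ℝ) *
      ∫ X in Set.pi Set.univ (fun _ : Fin n => Set.Icc (0 : ℝ) L),
        girardeauState (n + 1) L (Fin.snoc X a) * girardeauState (n + 1) L (Fin.snoc X b) := rfl
  rw [hdef, Complex.ofReal_mul, ← integral_complex_ofReal]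
  have hS : MeasurableSet (Set.pi Set.univ fun _ : Fin n => Set.Icc (0 : ℝ) L) :=
    MeasurableSet.univ_pi fun _ => measurableSet_Icc
  set Φ : ℂ := cexp (↑(π * (a - b) / L) * I) with hΦ
  set C2 : ℝ := ((n + 1).factorial : ℝ) * L ^ (n + 1) with hC2def
  have hC2 : (C2 : ℂ) ≠ 0 := by
    have : C2 ≠ 0 := by positivity
    exact_mod_cast this
  have hΦ0 : Φ ^ n ≠ 0 := pow_ne_zero _ (Complex.exp_ne_zero _)
  have hL0 : (L : ℂ) ≠ 0 := by exact_mod_cast hL.ne'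
  have hpt : ∀ X ∈ Set.pi Set.univ (fun _ : Fin n => Set.Icc (0 : ℝ) L),
      ((girardeauState (n + 1) L (Fin.snoc X a) * girardeauState (n + 1) L (Fin.snoc X b) :
        ℝ) : ℂ) =
      (C2 : ℂ)⁻¹ * (Φ ^ n)⁻¹ * ((∏ j, (sgnFun a b (X j) : ℂ)) *
        (det (vandermonde fun j => eL L ((Fin.cons a X : Fin (n + 1) → ℝ) j)) *
          conj (det (vandermonde fun j => eL L ((Fin.cons b X : Fin (n + 1) → ℝ) j))))) := by
    intro X hX
    have hX' : ∀ j, X j ∈ Set.Icc 0 L := fun j => hX j (Set.mem_univ _)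
    rw [sgn_det_det_eq_girardeau hL ha hb X hX', ← hC2def]
    field_simp
    ring
  rw [setIntegral_congr_fun hS hpt, integral_const_mul]
  have hμ : (volume : Measure (Fin n → ℝ)).restrict (Set.pi Set.univ fun _ => Set.Icc (0 : ℝ) L) =
      Measure.pi fun _ : Fin n => (volume : Measure ℝ).restrict (Set.Icc 0 L) := by
    rw [volume_pi, Measure.restrict_pi_pi]
  rw [hμ, integral_sgn_det_det, gramS_eq_smul hL ha hb, adjugate_smul, Fintype.card_fin,
    Nat.add_sub_cancel, smul_mulVec, dotProduct_smul, smul_eq_mul]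
  set B : ℂ := star (uVec n L b) ⬝ᵥ ((lenardMatrix n L a b).adjugate *ᵥ uVec n L a)
  have hn0 : ((n : ℂ) + 1) ≠ 0 := by exact_mod_cast Nat.succ_ne_zero n
  have hnf : (n.factorial : ℂ) ≠ 0 := by exact_mod_cast Nat.factorial_ne_zero n
  have key : (((n : ℝ) + 1 : ℝ) : ℂ) * (C2 : ℂ)⁻¹ * (n.factorial : ℂ) * (L : ℂ) ^ n =
      (L : ℂ)⁻¹ := by
    rw [hC2def, Nat.factorial_succ]
    push_cast
    field_simp
    ring
  calc (((n : ℝ) + 1 : ℝ) : ℂ) * ((C2 : ℂ)⁻¹ * (Φ ^ n)⁻¹ * ((n.factorial : ℂ) * ((L : ℂ) ^ n * B)))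
      = ((((n : ℝ) + 1 : ℝ) : ℂ) * (C2 : ℂ)⁻¹ * (n.factorial : ℂ) * (L : ℂ) ^ n) *
          ((Φ ^ n)⁻¹ * B) := by ring
    _ = (L : ℂ)⁻¹ * ((Φ ^ n)⁻¹ * B) := by rw [key]

end Gram


/-! ### Part F: an operator bound for the adjugate of a Hermitian matrix -/

section AdjugateBound

variable {m : Type*} [Fintype m] [DecidableEq m]

/-- `|d| ≤ exp((d² - 1)/2)` for every real `d` (from `1 + t ≤ eᵗ` and AM–GM). [folklore] -/
theorem abs_le_exp_sq_sub_one_half (d : ℝ) : |d| ≤ Real.exp ((d ^ 2 - 1) / 2) := by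
  have h1 : |d| ≤ (d ^ 2 - 1) / 2 + 1 := by
    have : 0 ≤ (|d| - 1) ^ 2 := sq_nonneg _
    have hsq : |d| ^ 2 = d ^ 2 := sq_abs d
    nlinarith
  exact h1.trans (Real.add_one_le_exp _)

omit [DecidableEq m] in
/-- The squared Euclidean norm `∑ ‖v i‖²` equals `re (star v ⬝ᵥ v)`. [folklore] -/
theorem sum_norm_sq_eq_re_dotProduct (v : m → ℂ) :
    ∑ i, ‖v i‖ ^ 2 = Complex.re (star v ⬝ᵥ v) := by
  simp only [dotProduct, Pi.star_apply, Complex.star_def, Complex.re_sum]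
  refine Finset.sum_congr rfl fun i _ => ?_
  rw [Complex.conj_mul', ← Complex.ofReal_pow, Complex.ofReal_re]

/-- Unitary matrices preserve the Euclidean norm. [folklore] -/
theorem sum_norm_sq_unitary_mulVec (U : Matrix.unitaryGroup m ℂ) (v : m → ℂ) :
    ∑ i, ‖(star (U : Matrix m m ℂ) *ᵥ v) i‖ ^ 2 = ∑ i, ‖v i‖ ^ 2 := by
  rw [sum_norm_sq_eq_re_dotProduct, sum_norm_sq_eq_re_dotProduct, star_mulVec,
    ← star_eq_conjTranspose, star_star, ← dotProduct_mulVec, mulVec_mulVec,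
    show (U : Matrix m m ℂ) * star (U : Matrix m m ℂ) = 1 from Unitary.coe_mul_star_self U,
    one_mulVec]

/-- `adj U = det U · U*` for unitary `U`. [folklore] -/
theorem adjugate_unitary (U : Matrix.unitaryGroup m ℂ) :
    (U : Matrix m m ℂ).adjugate = (U : Matrix m m ℂ).det • star (U : Matrix m m ℂ) := by
  have h := adjugate_mul (U : Matrix m m ℂ)
  calc (U : Matrix m m ℂ).adjugate
      = (U : Matrix m m ℂ).adjugate * ((U : Matrix m m ℂ) * star (U : Matrix m m ℂ)) := by
        rw [show (U : Matrix m m ℂ) * star (U : Matrix m m ℂ) = 1 from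
          Unitary.coe_mul_star_self U, mul_one]
    _ = (U : Matrix m m ℂ).det • star (U : Matrix m m ℂ) := by
        rw [← mul_assoc, h, smul_mul_assoc, one_mul]

/-- `adj U* = det U* · U` for unitary `U`. [folklore] -/
theorem adjugate_star_unitary (U : Matrix.unitaryGroup m ℂ) :
    (star (U : Matrix m m ℂ)).adjugate = (star (U : Matrix m m ℂ)).det • (U : Matrix m m ℂ) := by
  have h := adjugate_mul (star (U : Matrix m m ℂ))
  calc (star (U : Matrix m m ℂ)).adjugate
      = (star (U : Matrix m m ℂ)).adjugate * (star (U : Matrix m m ℂ) * (U : Matrix m m ℂ)) := by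
        rw [show star (U : Matrix m m ℂ) * (U : Matrix m m ℂ) = 1 from
          Unitary.coe_star_mul_self U, mul_one]
    _ = (star (U : Matrix m m ℂ)).det • (U : Matrix m m ℂ) := by
        rw [← mul_assoc, h, smul_mul_assoc, one_mul]

/-- **Operator bound for the adjugate of a Hermitian matrix.** For Hermitian `A` and any
vectors `x, y`: `|⟨x, adj(A) y⟩| ≤ e^{1/2} · exp((tr A² − N)/2) · ‖x‖ ‖y‖`. The point is
that every product of all-but-one eigenvalues is at most `e^{1/2} exp((∑ν² − N)/2)` because
`|ν| ≤ exp((ν² − 1)/2)`. [folklore] -/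
theorem norm_star_dotProduct_adjugate_mulVec_le {A : Matrix m m ℂ} (hA : A.IsHermitian)
    (x y : m → ℂ) :
    ‖star x ⬝ᵥ (A.adjugate *ᵥ y)‖ ≤
      Real.exp (1 / 2) * Real.exp ((Complex.re (A * A).trace - Fintype.card m) / 2) *
        (Real.sqrt (∑ i, ‖x i‖ ^ 2) * Real.sqrt (∑ i, ‖y i‖ ^ 2)) := by
  -- diagonalize
  set U := hA.eigenvectorUnitary with hU
  set d : m → ℝ := hA.eigenvalues with hd
  set D : Matrix m m ℂ := diagonal (RCLike.ofReal ∘ d) with hD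
  have hspec : A = (U : Matrix m m ℂ) * D * star (U : Matrix m m ℂ) := by
    have := hA.spectral_theorem
    rwa [Unitary.conjStarAlgAut_apply] at this
  -- the adjugate
  have hdet1 : (star (U : Matrix m m ℂ)).det * (U : Matrix m m ℂ).det = 1 := by
    rw [← det_mul, show star (U : Matrix m m ℂ) * (U : Matrix m m ℂ) = 1 from
      Unitary.coe_star_mul_self U, det_one]
  have hadj : A.adjugate = (U : Matrix m m ℂ) * D.adjugate * star (U : Matrix m m ℂ) := by
    rw [hspec, adjugate_mul_distrib, adjugate_mul_distrib, adjugate_unitary,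
      adjugate_star_unitary, smul_mul_assoc, mul_smul_comm, mul_smul_comm, smul_smul]
    rw [hdet1, one_smul, mul_assoc]
  have hadjD : D.adjugate = diagonal fun i => ∏ j ∈ univ.erase i, ((d j : ℝ) : ℂ) := by
    rw [hD, adjugate_diagonal]; rfl
  -- rewrite the bilinear form in the eigenbasis
  set x' := star (U : Matrix m m ℂ) *ᵥ x with hx'
  set y' := star (U : Matrix m m ℂ) *ᵥ y with hy'
  set c : m → ℂ := fun i => ∏ j ∈ univ.erase i, ((d j : ℝ) : ℂ) with hc
  have hform : star x ⬝ᵥ (A.adjugate *ᵥ y) = ∑ i, star (x' i) * (c i * y' i) := by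
    rw [hadj, ← mulVec_mulVec, ← mulVec_mulVec, dotProduct_mulVec,
      show star x ᵥ* (U : Matrix m m ℂ) = star x' by
        rw [hx', star_mulVec, ← star_eq_conjTranspose, star_star], hadjD]
    simp only [dotProduct, mulVec_diagonal, Pi.star_apply, hy']
  -- bound on the cofactors `c i`
  set T : ℝ := Complex.re (A * A).trace with hT
  have htrace : T = ∑ j, d j ^ 2 := by
    have h2 : A * A = (U : Matrix m m ℂ) * (D * D) * star (U : Matrix m m ℂ) := by
      rw [hspec]
      calc (U : Matrix m m ℂ) * D * star (U : Matrix m m ℂ) *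
            ((U : Matrix m m ℂ) * D * star (U : Matrix m m ℂ))
          = (U : Matrix m m ℂ) * D * (star (U : Matrix m m ℂ) * (U : Matrix m m ℂ)) * D *
              star (U : Matrix m m ℂ) := by simp only [mul_assoc]
        _ = (U : Matrix m m ℂ) * (D * D) * star (U : Matrix m m ℂ) := by
              rw [show star (U : Matrix m m ℂ) * (U : Matrix m m ℂ) = 1 from
                Unitary.coe_star_mul_self U, mul_one, mul_assoc (U : Matrix m m ℂ)]
    rw [hT, h2, trace_mul_cycle, show star (U : Matrix m m ℂ) * (U : Matrix m m ℂ) = 1 from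
      Unitary.coe_star_mul_self U, one_mul, hD, diagonal_mul_diagonal, trace_diagonal,
      Complex.re_sum]
    refine Finset.sum_congr rfl fun j _ => ?_
    simp [sq]
  have hcbound : ∀ i, ‖c i‖ ≤ Real.exp (1 / 2) * Real.exp ((T - Fintype.card m) / 2) := by
    intro i
    rw [hc]
    simp only [norm_prod, Complex.norm_real, Real.norm_eq_abs]
    calc ∏ j ∈ univ.erase i, |d j|
        ≤ ∏ j ∈ univ.erase i, Real.exp ((d j ^ 2 - 1) / 2) :=
          Finset.prod_le_prod (fun j _ => abs_nonneg _) fun j _ => abs_le_exp_sq_sub_one_half _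
      _ = Real.exp (∑ j ∈ univ.erase i, (d j ^ 2 - 1) / 2) := (Real.exp_sum _ _).symm
      _ ≤ Real.exp (1 / 2) * Real.exp ((T - Fintype.card m) / 2) := by
          rw [← Real.exp_add]
          apply Real.exp_le_exp.mpr
          have hsum : ∑ j ∈ univ.erase i, (d j ^ 2 - 1) / 2 + (d i ^ 2 - 1) / 2 =
              ∑ j, (d j ^ 2 - 1) / 2 := Finset.sum_erase_add _ _ (Finset.mem_univ i)
          have hall : ∑ j, (d j ^ 2 - 1) / 2 = (T - Fintype.card m) / 2 := by
            rw [htrace, ← Finset.sum_div, Finset.sum_sub_distrib, Finset.sum_const,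
              Finset.card_univ, nsmul_eq_mul, mul_one]
          nlinarith [sq_nonneg (d i)]
  -- Cauchy–Schwarz
  set K := Real.exp (1 / 2) * Real.exp ((T - Fintype.card m) / 2) with hK
  have hK0 : 0 ≤ K := by positivity
  rw [hform]
  calc ‖∑ i, star (x' i) * (c i * y' i)‖
      ≤ ∑ i, ‖star (x' i) * (c i * y' i)‖ := norm_sum_le _ _
    _ = ∑ i, ‖c i‖ * (‖x' i‖ * ‖y' i‖) := by
        refine Finset.sum_congr rfl fun i _ => ?_
        rw [norm_mul, norm_mul, norm_star]; ring
    _ ≤ ∑ i, K * (‖x' i‖ * ‖y' i‖) :=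
        Finset.sum_le_sum fun i _ => mul_le_mul_of_nonneg_right (hcbound i) (by positivity)
    _ = K * ∑ i, ‖x' i‖ * ‖y' i‖ := (Finset.mul_sum _ _ _).symm
    _ ≤ K * (Real.sqrt (∑ i, ‖x' i‖ ^ 2) * Real.sqrt (∑ i, ‖y' i‖ ^ 2)) :=
        mul_le_mul_of_nonneg_left (Real.sum_mul_le_sqrt_mul_sqrt _ _ _) hK0
    _ = K * (Real.sqrt (∑ i, ‖x i‖ ^ 2) * Real.sqrt (∑ i, ‖y i‖ ^ 2)) := by
        rw [hx', hy', sum_norm_sq_unitary_mulVec, sum_norm_sq_unitary_mulVec]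

end AdjugateBound



/-! ### Part G: Lenard's matrix is Hermitian; its Hilbert–Schmidt defect is a number variance -/

section LenardMatrix

variable {n : ℕ} {L a b : ℝ}

/-- `conj e^{2πimx/L} = e^{−2πimx/L}`. [folklore] -/
theorem conj_ez (L : ℝ) (m : ℤ) (x : ℝ) : conj (ez L m x) = ez L (-m) x := by
  unfold ez
  rw [← Complex.exp_conj]
  congr 1
  simp only [map_mul, Complex.conj_ofReal, Complex.conj_I]
  push_cast
  ring

/-- The zero mode is the constant `1`. [folklore] -/
theorem ez_zero (L x : ℝ) : ez L 0 x = 1 := by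
  simp [ez]

/-- `e_m · conj e_{m'} = e_{m−m'}`. [folklore] -/
theorem ez_mul_conj_ez (L : ℝ) (m m' : ℤ) (x : ℝ) :
    ez L m x * conj (ez L m' x) = ez L (m - m') x := by
  rw [conj_ez]
  unfold ez
  rw [← Complex.exp_add]
  congr 1
  push_cast
  ring

/-- `conj q(m) = q(−m)` (the indicator is real). [folklore] -/
theorem qCoeff_conj (L a b : ℝ) (m : ℤ) : conj (qCoeff L a b m) = qCoeff L a b (-m) := by
  unfold qCoeff
  rw [map_mul, ← integral_conj]
  simp only [map_inv₀, Complex.conj_ofReal, conj_ez]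

/-- `q(0) = |a − b|/L`, the relative arc length (the expected fraction of particles in the arc).
[folklore] -/
theorem qCoeff_zero (L a b : ℝ) : qCoeff L a b 0 = ((|a - b| / L : ℝ) : ℂ) := by
  unfold qCoeff
  simp only [ez_zero, setIntegral_const,
    Real.volume_real_Ioo_of_le (min_le_max : min a b ≤ max a b), max_sub_min_eq_abs',
    Complex.real_smul, mul_one]
  push_cast
  ring

/-- Lenard's matrix `1 − 2Q` is Hermitian. [folklore] -/
theorem lenardMatrix_isHermitian (n : ℕ) (L a b : ℝ) : (lenardMatrix n L a b).IsHermitian := by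
  refine Matrix.IsHermitian.ext fun k l => ?_
  simp only [lenardMatrix, of_apply, star_sub, star_mul, Complex.star_def, qCoeff_conj,
    map_ofNat, neg_sub]
  congr 1
  · by_cases h : k = l
    · subst h; simp
    · rw [if_neg h, if_neg (Ne.symm h), map_zero]
  · rw [mul_comm]

/-- The "number variance" `V = N |a-b|/L − ∑_{k,l<N} |q(k−l)|²` (for the free-fermion
process this is the variance of the number of particles in the arc between `a` and `b`).
[folklore] -/
def numVar (N : ℕ) (L a b : ℝ) : ℝ :=
  N * (|a - b| / L) -
    ∑ k ∈ Finset.range N, ∑ l ∈ Finset.range N, ‖qCoeff L a b ((k : ℤ) - (l : ℤ))‖ ^ 2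

/-- Squared moduli of the entries of `1 − 2Q`. [folklore] -/
theorem norm_sq_lenardMatrix_entry (n : ℕ) (L a b : ℝ) (k l : Fin (n + 1)) :
    ‖lenardMatrix n L a b k l‖ ^ 2 =
      (if k = l then 1 - 4 * (|a - b| / L) else 0) +
        4 * ‖qCoeff L a b ((k : ℤ) - (l : ℤ))‖ ^ 2 := by
  simp only [lenardMatrix, of_apply]
  by_cases h : k = l
  · subst h
    simp only [if_true, sub_self, qCoeff_zero]
    rw [show (1 : ℂ) - 2 * (((|a - b| / L : ℝ)) : ℂ) = ((1 - 2 * (|a - b| / L) : ℝ) : ℂ) by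
      push_cast; ring, Complex.norm_real, Complex.norm_real, Real.norm_eq_abs, Real.norm_eq_abs,
      sq_abs, sq_abs]
    ring
  · rw [if_neg h, if_neg h, zero_sub, norm_neg, norm_mul, Complex.norm_ofNat, zero_add]
    ring

/-- `re tr(M²) − N = −4 V`. [folklore] -/
theorem re_trace_lenardMatrix_sq (n : ℕ) (L a b : ℝ) :
    Complex.re ((lenardMatrix n L a b * lenardMatrix n L a b).trace) - (n + 1 : ℕ) =
      -4 * numVar (n + 1) L a b := by
  set M := lenardMatrix n L a b with hM
  have hH : M.IsHermitian := lenardMatrix_isHermitian n L a b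
  have htr : Complex.re ((M * M).trace) = ∑ k : Fin (n + 1), ∑ l : Fin (n + 1), ‖M k l‖ ^ 2 := by
    simp only [Matrix.trace, Matrix.diag, Matrix.mul_apply, Complex.re_sum]
    refine Finset.sum_congr rfl fun k _ => Finset.sum_congr rfl fun l _ => ?_
    rw [← hH.apply l k, Complex.star_def, mul_conj_eq_norm_sq, Complex.ofReal_re]
  rw [htr]
  simp_rw [hM, norm_sq_lenardMatrix_entry, Finset.sum_add_distrib, Finset.sum_ite_eq,
    Finset.mem_univ, if_true, Finset.sum_const, Finset.card_univ, Fintype.card_fin,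
    nsmul_eq_mul, ← Finset.mul_sum]
  unfold numVar
  rw [← Fin.sum_univ_eq_sum_range (fun k => ∑ l ∈ Finset.range (n + 1),
      ‖qCoeff L a b ((k : ℤ) - (l : ℤ))‖ ^ 2) (n + 1)]
  simp_rw [← Fin.sum_univ_eq_sum_range (fun l => ‖qCoeff L a b ((_ : ℤ) - (l : ℤ))‖ ^ 2) (n + 1)]
  push_cast
  ring

/-- Closed form of the Fourier coefficients of the arc indicator: for `m ≠ 0`,
`|q(m)|² = sin²(π m (a-b)/L) / (π² m²)`. [folklore] -/
theorem norm_sq_qCoeff (hL : 0 < L) (a b : ℝ) {m : ℤ} (hm : m ≠ 0) :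
    ‖qCoeff L a b m‖ ^ 2 = Real.sin (π * m * (a - b) / L) ^ 2 / (π ^ 2 * m ^ 2) := by
  unfold qCoeff
  rw [← integral_Ioc_eq_integral_Ioo, ← intervalIntegral.integral_of_le
    (min_le_max : min a b ≤ max a b)]
  set c : ℂ := ↑(2 * π * m / L) * I with hc
  have hc0 : c ≠ 0 := by
    refine mul_ne_zero ?_ Complex.I_ne_zero
    exact_mod_cast (by positivity : (2 * π * m / L : ℝ) ≠ 0)
  have hfun : (fun x : ℝ => ez L m x) = fun x : ℝ => cexp (c * x) := by
    ext x; unfold ez; congr 1; rw [hc]; push_cast; ring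
  rw [hfun, integral_exp_mul_complex hc0]
  have h1 : c * (max a b : ℝ) = ↑(2 * π * m * max a b / L) * I := by rw [hc]; push_cast; ring
  have h2 : c * (min a b : ℝ) = ↑(2 * π * m * min a b / L) * I := by rw [hc]; push_cast; ring
  rw [h1, h2, norm_mul, norm_div, norm_exp_I_sub_exp_I, norm_inv, Complex.norm_real,
    Real.norm_eq_abs, abs_of_pos hL, hc, norm_mul, Complex.norm_I, mul_one, Complex.norm_real,
    Real.norm_eq_abs]
  have hmm : max a b - min a b = |a - b| := max_sub_min_eq_abs' a b
  have hsin : |Real.sin ((2 * π * ↑m * max a b / L - 2 * π * ↑m * min a b / L) / 2)| =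
      |Real.sin (π * m * (a - b) / L)| := by
    rw [show (2 * π * ↑m * max a b / L - 2 * π * ↑m * min a b / L) / 2 =
      π * m * (max a b - min a b) / L by ring, hmm]
    rcases abs_choice (a - b) with h | h <;> rw [h]
    rw [show π * ↑m * -(a - b) / L = -(π * ↑m * (a - b) / L) by ring, Real.sin_neg, abs_neg]
  rw [hsin]
  have hpos : (0 : ℝ) < 2 * π * |(m : ℝ)| / L := by
    have : (0 : ℝ) < |(m : ℝ)| := abs_pos.mpr (by exact_mod_cast hm)
    positivity
  rw [show |2 * π * (m : ℝ) / L| = 2 * π * |(m : ℝ)| / L by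
    rw [abs_div, abs_mul, abs_mul, abs_of_pos hL, abs_two, abs_of_pos Real.pi_pos]]
  have hL0 : L ≠ 0 := hL.ne'
  have hmabs : |(m : ℝ)| ≠ 0 := abs_ne_zero.mpr (by exact_mod_cast hm)
  have step : L⁻¹ * (2 * |Real.sin (π * ↑m * (a - b) / L)| / (2 * π * |(m : ℝ)| / L)) =
      |Real.sin (π * ↑m * (a - b) / L)| / (π * |(m : ℝ)|) := by
    field_simp
  rw [step, div_pow, mul_pow, sq_abs, sq_abs]

end LenardMatrix


/-! ### Part G (cont.): Bessel's inequality for the arc indicator -/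

section Bessel

variable {L a b : ℝ}

/-- **Bessel's inequality** for the plane waves `e^{2πimx/L}/√L` on `[0, L]` applied to the
indicator of the arc between `a` and `b`: `∑_{m ∈ S} |q(m)|² ≤ |a − b|/L`. [folklore] -/
theorem sum_norm_sq_qCoeff_le (hL : 0 < L) (ha : a ∈ Set.Icc 0 L) (hb : b ∈ Set.Icc 0 L)
    (S : Finset ℤ) :
    ∑ m ∈ S, ‖qCoeff L a b m‖ ^ 2 ≤ |a - b| / L := by
  set I0 := Set.Ioo (min a b) (max a b) with hI0
  set q := qCoeff L a b with hq
  set B : ℝ := ∑ m ∈ S, ‖q m‖ ^ 2 with hB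
  set g : ℝ → ℂ := fun x => ∑ m ∈ S, conj (q m) * ez L m x with hg
  have hsub : I0 ⊆ Set.Icc 0 L := Ioo_subset_Icc_of_mem ha hb
  have hg_cont : Continuous g :=
    continuous_finsetSum _ fun m _ => continuous_const.mul (continuous_ez L m)
  have hterm_int : ∀ (m : ℤ) (s : Set ℝ), s ⊆ Set.Icc 0 L →
      IntegrableOn (fun x => conj (q m) * ez L m x) s := fun m s hs =>
    ((continuous_const.mul (continuous_ez L m)).integrableOn_Icc).mono_set hs
  -- (i) `∫_{I0} g = L B`
  have h1 : ∫ x in I0, g x = ((L * B : ℝ) : ℂ) := by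
    rw [hg]
    simp only
    rw [integral_finsetSum _ fun m _ => hterm_int m I0 hsub]
    have hm : ∀ m ∈ S, ∫ x in I0, conj (q m) * ez L m x = (L : ℂ) * ((‖q m‖ ^ 2 : ℝ) : ℂ) := by
      intro m _
      rw [integral_const_mul]
      have : ∫ x in I0, ez L m x = (L : ℂ) * q m := by
        rw [hq]; unfold qCoeff
        rw [← mul_assoc, mul_inv_cancel₀ (by exact_mod_cast hL.ne'), one_mul]
      rw [this, mul_left_comm, Complex.conj_mul', Complex.ofReal_pow]
    rw [Finset.sum_congr rfl hm, ← Finset.mul_sum, hB]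
    push_cast
    rfl
  -- (ii) `∫_{[0,L]} ‖g‖² = L B`
  have h2 : ∫ x in Set.Icc 0 L, ‖g x‖ ^ 2 = L * B := by
    have hpt : ∀ x, ((‖g x‖ ^ 2 : ℝ) : ℂ) =
        ∑ m ∈ S, ∑ m' ∈ S, (q m * conj (q m')) * ez L (m' - m) x := by
      intro x
      rw [← mul_conj_eq_norm_sq, hg]
      simp only [map_sum, map_mul, Complex.conj_conj, Finset.sum_mul, Finset.mul_sum]
      refine Finset.sum_congr rfl fun m _ => Finset.sum_congr rfl fun m' _ => ?_
      rw [← ez_mul_conj_ez]; ring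
    have hint2 : ∀ m m' : ℤ, IntegrableOn (fun x => (q m * conj (q m')) * ez L (m' - m) x)
        (Set.Icc 0 L) := fun m m' =>
      (continuous_const.mul (continuous_ez L _)).integrableOn_Icc
    have hC : ((∫ x in Set.Icc 0 L, ‖g x‖ ^ 2 : ℝ) : ℂ) = ((L * B : ℝ) : ℂ) := by
      rw [← integral_complex_ofReal]
      simp_rw [hpt]
      rw [integral_finsetSum _ fun m _ => integrable_finsetSum _ fun m' _ => hint2 m m']
      simp_rw [integral_finsetSum _ fun m' _ => hint2 _ m', integral_const_mul,
        integral_ez_Icc hL, sub_eq_zero, mul_ite, mul_zero]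
      simp_rw [Finset.sum_ite_eq', hB]
      push_cast
      rw [Finset.mul_sum]
      refine Finset.sum_congr rfl fun m hm => ?_
      rw [if_pos hm, mul_conj_eq_norm_sq]; push_cast; ring
    exact_mod_cast hC
  -- (iii) the chain of inequalities
  have hgI : IntegrableOn g I0 := (hg_cont.integrableOn_Icc).mono_set hsub
  have hg2 : IntegrableOn (fun x => ‖g x‖ ^ 2) (Set.Icc 0 L) :=
    ((hg_cont.norm.pow 2).integrableOn_Icc)
  have hg2I : IntegrableOn (fun x => ‖g x‖ ^ 2) I0 := hg2.mono_set hsub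
  have hvol : volume.real I0 = |a - b| := by
    rw [hI0, Real.volume_real_Ioo_of_le min_le_max, max_sub_min_eq_abs']
  have hchain : L * B ≤ (L * B) / 2 + |a - b| / 2 := by
    calc L * B = Complex.re (∫ x in I0, g x) := by rw [h1, Complex.ofReal_re]
      _ ≤ ‖∫ x in I0, g x‖ := Complex.re_le_norm _
      _ ≤ ∫ x in I0, ‖g x‖ := norm_integral_le_integral_norm _
      _ ≤ ∫ x in I0, (‖g x‖ ^ 2 + 1) / 2 := by
          refine integral_mono hgI.norm ((hg2I.add (integrable_const _)).div_const _) fun x => ?_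
          simp only
          nlinarith [sq_nonneg (‖g x‖ - 1)]
      _ = (∫ x in I0, ‖g x‖ ^ 2) / 2 + |a - b| / 2 := by
          rw [integral_div, integral_add hg2I (integrable_const _), setIntegral_const, hvol,
            smul_eq_mul, mul_one, add_div]
      _ ≤ (∫ x in Set.Icc 0 L, ‖g x‖ ^ 2) / 2 + |a - b| / 2 := by
          have hmono : ∫ x in I0, ‖g x‖ ^ 2 ≤ ∫ x in Set.Icc 0 L, ‖g x‖ ^ 2 :=
            setIntegral_mono_set hg2 (Filter.Eventually.of_forall fun x => sq_nonneg _)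
              hsub.eventuallyLE
          linarith
      _ = (L * B) / 2 + |a - b| / 2 := by rw [h2]
  rw [le_div_iff₀ hL]
  linarith

end Bessel


/-! ### Part G (cont.): logarithmic divergence of the number variance -/

section Divergence

variable {L a b : ℝ}

/-- `sin²φ ≤ 2(sin²y + sin²(y+φ))`: two consecutive multiples of `φ` cannot both be close to `πℤ`.
[folklore] -/
theorem sin_sq_le_two_mul (y φ : ℝ) :
    Real.sin φ ^ 2 ≤ 2 * (Real.sin y ^ 2 + Real.sin (y + φ) ^ 2) := by
  set s0 := Real.sin y
  set c0 := Real.cos y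
  set s1 := Real.sin (y + φ)
  set c1 := Real.cos (y + φ)
  have h1 : Real.sin φ = s1 * c0 - c1 * s0 := by
    have := Real.sin_sub (y + φ) y
    rwa [show y + φ - y = φ by ring] at this
  have h2 : (s1 * c0 - c1 * s0) ^ 2 + (s1 * c1 + s0 * c0) ^ 2 =
      (s1 ^ 2 + s0 ^ 2) * (c0 ^ 2 + c1 ^ 2) := by ring
  have hc0 : c0 ^ 2 ≤ 1 := Real.cos_sq_le_one y
  have hc1 : c1 ^ 2 ≤ 1 := Real.cos_sq_le_one (y + φ)
  calc Real.sin φ ^ 2 = (s1 * c0 - c1 * s0) ^ 2 := by rw [h1]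
    _ ≤ (s1 ^ 2 + s0 ^ 2) * (c0 ^ 2 + c1 ^ 2) := by nlinarith [h2, sq_nonneg (s1 * c1 + s0 * c0)]
    _ ≤ (s1 ^ 2 + s0 ^ 2) * 2 := by
        apply mul_le_mul_of_nonneg_left (by linarith) (by positivity)
    _ = 2 * (s0 ^ 2 + s1 ^ 2) := by ring

/-- Pairing consecutive terms of a sum over `range (2K)`. [folklore] -/
theorem sum_range_two_mul (f : ℕ → ℝ) (K : ℕ) :
    ∑ j ∈ Finset.range (2 * K), f j = ∑ i ∈ Finset.range K, (f (2 * i) + f (2 * i + 1)) := by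
  induction K with
  | zero => simp
  | succ K ih =>
      rw [show 2 * (K + 1) = 2 * K + 1 + 1 by ring, Finset.sum_range_succ, Finset.sum_range_succ,
        Finset.sum_range_succ, ih]
      ring

/-- The tail block `∑_{j < 2N+2} |q(N+1+j)|²` is at least `sin²(π(a-b)/L) / (18 π² (N+1))`.
[folklore] -/
theorem tail_block_lower_bound (hL : 0 < L) (a b : ℝ) (N : ℕ) :
    Real.sin (π * (a - b) / L) ^ 2 / (18 * π ^ 2 * (N + 1)) ≤
      ∑ j ∈ Finset.range (2 * N + 2), ‖qCoeff L a b ((N : ℤ) + 1 + j)‖ ^ 2 := by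
  set φ := π * (a - b) / L with hφ
  have hterm : ∀ j ∈ Finset.range (2 * N + 2),
      Real.sin (((N : ℝ) + 1 + j) * φ) ^ 2 / (π ^ 2 * (3 * N + 3) ^ 2) ≤
        ‖qCoeff L a b ((N : ℤ) + 1 + j)‖ ^ 2 := by
    intro j hj
    rw [Finset.mem_range] at hj
    have hm : ((N : ℤ) + 1 + j) ≠ 0 := by omega
    rw [norm_sq_qCoeff hL a b hm]
    have hcast : (((N : ℤ) + 1 + j : ℤ) : ℝ) = (N : ℝ) + 1 + j := by push_cast; ring
    rw [hcast, show π * ((N : ℝ) + 1 + j) * (a - b) / L = ((N : ℝ) + 1 + j) * φ by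
      rw [hφ]; ring]
    apply div_le_div_of_nonneg_left (sq_nonneg _) (by positivity)
    apply mul_le_mul_of_nonneg_left _ (by positivity)
    have : (N : ℝ) + 1 + j ≤ 3 * N + 3 := by
      have : (j : ℝ) ≤ 2 * N + 1 := by exact_mod_cast (by omega : j ≤ 2 * N + 1)
      linarith
    exact pow_le_pow_left₀ (by positivity) this 2
  refine le_trans ?_ (Finset.sum_le_sum hterm)
  rw [← Finset.sum_div]
  have hpair : ((N : ℝ) + 1) * (Real.sin φ ^ 2 / 2) ≤
      ∑ j ∈ Finset.range (2 * N + 2), Real.sin (((N : ℝ) + 1 + j) * φ) ^ 2 := by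
    rw [show 2 * N + 2 = 2 * (N + 1) by ring, sum_range_two_mul]
    have : ∀ i ∈ Finset.range (N + 1), Real.sin φ ^ 2 / 2 ≤
        Real.sin (((N : ℝ) + 1 + (2 * i : ℕ)) * φ) ^ 2 +
          Real.sin (((N : ℝ) + 1 + (2 * i + 1 : ℕ)) * φ) ^ 2 := by
      intro i _
      have h := sin_sq_le_two_mul (((N : ℝ) + 1 + (2 * i : ℕ)) * φ) φ
      rw [show ((N : ℝ) + 1 + (2 * i : ℕ)) * φ + φ = ((N : ℝ) + 1 + (2 * i + 1 : ℕ)) * φ by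
        push_cast; ring] at h
      linarith
    refine le_trans ?_ (Finset.sum_le_sum this)
    rw [Finset.sum_const, Finset.card_range, nsmul_eq_mul]
    push_cast
    exact le_of_eq (by ring)
  rw [div_le_div_iff₀ (by positivity) (by positivity)]
  have h18 : Real.sin φ ^ 2 * (π ^ 2 * (3 * (N : ℝ) + 3) ^ 2) =
      (((N : ℝ) + 1) * (Real.sin φ ^ 2 / 2)) * (18 * π ^ 2 * (N + 1)) := by ring
  rw [h18]
  exact mul_le_mul_of_nonneg_right hpair (by positivity)

/-- One induction step: `V(N+1) ≥ V(N) + (tail block)`, by Bessel's inequality applied to the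
frequencies `[-N, N] ∪ [N+1, 3N+2]`. [folklore] -/
theorem numVar_succ_ge (hL : 0 < L) (ha : a ∈ Set.Icc 0 L) (hb : b ∈ Set.Icc 0 L) (N : ℕ) :
    numVar N L a b + ∑ j ∈ Finset.range (2 * N + 2), ‖qCoeff L a b ((N : ℤ) + 1 + j)‖ ^ 2 ≤
      numVar (N + 1) L a b := by
  set q := qCoeff L a b with hq
  set D := ∑ j ∈ Finset.range (2 * N + 2), ‖q ((N : ℤ) + 1 + j)‖ ^ 2 with hD
  -- the four frequency blocks
  set S1 : Finset ℤ := (Finset.range N).image fun l : ℕ => (N : ℤ) - l with hS1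
  set S2 : Finset ℤ := (Finset.range N).image fun k : ℕ => (k : ℤ) - N with hS2
  set S3 : Finset ℤ := {0} with hS3
  set S4 : Finset ℤ := (Finset.range (2 * N + 2)).image fun j : ℕ => (N : ℤ) + 1 + j with hS4
  have hsum1 : ∑ m ∈ S1, ‖q m‖ ^ 2 = ∑ l ∈ Finset.range N, ‖q ((N : ℤ) - l)‖ ^ 2 := by
    rw [hS1, Finset.sum_image]
    intro x _ y _ h; simp only at h; omega
  have hsum2 : ∑ m ∈ S2, ‖q m‖ ^ 2 = ∑ k ∈ Finset.range N, ‖q ((k : ℤ) - N)‖ ^ 2 := by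
    rw [hS2, Finset.sum_image]
    intro x _ y _ h; simp only at h; omega
  have hsum3 : ∑ m ∈ S3, ‖q m‖ ^ 2 = ‖q 0‖ ^ 2 := by rw [hS3, Finset.sum_singleton]
  have hsum4 : ∑ m ∈ S4, ‖q m‖ ^ 2 = D := by
    rw [hS4, Finset.sum_image]
    intro x _ y _ h; simp only at h; omega
  have hd12 : Disjoint S1 S2 := by
    rw [Finset.disjoint_left]
    intro m hm1 hm2
    simp only [hS1, hS2, Finset.mem_image, Finset.mem_range] at hm1 hm2
    obtain ⟨l, hl, rfl⟩ := hm1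
    obtain ⟨k, hk, hk'⟩ := hm2
    omega
  have hd123 : Disjoint (S1 ∪ S2) S3 := by
    rw [Finset.disjoint_left]
    intro m hm hm3
    simp only [hS3, Finset.mem_singleton] at hm3
    subst hm3
    simp only [hS1, hS2, Finset.mem_union, Finset.mem_image, Finset.mem_range] at hm
    rcases hm with ⟨l, hl, hl'⟩ | ⟨k, hk, hk'⟩ <;> omega
  have hd1234 : Disjoint (S1 ∪ S2 ∪ S3) S4 := by
    rw [Finset.disjoint_left]
    intro m hm hm4
    simp only [hS4, Finset.mem_image, Finset.mem_range] at hm4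
    obtain ⟨j, hj, rfl⟩ := hm4
    simp only [hS1, hS2, hS3, Finset.mem_union, Finset.mem_image, Finset.mem_range,
      Finset.mem_singleton] at hm
    rcases hm with (⟨l, hl, hl'⟩ | ⟨k, hk, hk'⟩) | h0 <;> omega
  have hBessel := sum_norm_sq_qCoeff_le hL ha hb (S1 ∪ S2 ∪ S3 ∪ S4)
  rw [Finset.sum_union hd1234, Finset.sum_union hd123, Finset.sum_union hd12, ← hq, hsum1, hsum2,
    hsum3, hsum4] at hBessel
  -- expand `T(N+1)`
  have hT : ∑ k ∈ Finset.range (N + 1), ∑ l ∈ Finset.range (N + 1), ‖q ((k : ℤ) - (l : ℤ))‖ ^ 2 =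
      ∑ k ∈ Finset.range N, ∑ l ∈ Finset.range N, ‖q ((k : ℤ) - (l : ℤ))‖ ^ 2 +
        (∑ l ∈ Finset.range N, ‖q ((N : ℤ) - l)‖ ^ 2 +
          ∑ k ∈ Finset.range N, ‖q ((k : ℤ) - N)‖ ^ 2 + ‖q 0‖ ^ 2) := by
    simp only [Finset.sum_range_succ, Finset.sum_add_distrib, sub_self]
    ring
  unfold numVar
  rw [← hq, hT]
  push_cast
  nlinarith [hBessel]

/-- **Logarithmic growth of the number variance**:
`V(N) ≥ sin²(π(a−b)/L)/(18π²) · ∑_{j<N} 1/(j+1)`. [folklore] -/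
theorem numVar_ge_harmonic (hL : 0 < L) (ha : a ∈ Set.Icc 0 L) (hb : b ∈ Set.Icc 0 L) (N : ℕ) :
    Real.sin (π * (a - b) / L) ^ 2 / (18 * π ^ 2) * ∑ j ∈ Finset.range N, 1 / ((j : ℝ) + 1) ≤
      numVar N L a b := by
  induction N with
  | zero => simp [numVar]
  | succ N ih =>
      have hstep := numVar_succ_ge hL ha hb N
      have htail := tail_block_lower_bound hL a b N
      rw [Finset.sum_range_succ, mul_add]
      have : Real.sin (π * (a - b) / L) ^ 2 / (18 * π ^ 2) * (1 / ((N : ℝ) + 1)) =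
          Real.sin (π * (a - b) / L) ^ 2 / (18 * π ^ 2 * (N + 1)) := by
        field_simp
      rw [this]
      linarith

end Divergence


/-! ### Part H: assembly — the density-matrix bound and the `o(N)` law -/

section Assembly

variable {n : ℕ} {L a b : ℝ}

/-- The one-body density matrix of the (non-negative) Girardeau state has non-negative kernel.
[cite: ForresterEtAl2003, §2.1.1] -/
theorem girardeauDensityMatrix_nonneg (N : ℕ) (L x y : ℝ) : 0 ≤ girardeauDensityMatrix N L x y := by
  cases N with
  | zero => simp [girardeauDensityMatrix]
  | succ n =>
      show (0 : ℝ) ≤ (n + 1 : ℝ) * ∫ X in Set.pi Set.univ (fun _ : Fin n => Set.Icc (0 : ℝ) L),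
        girardeauState (n + 1) L (Fin.snoc X x) * girardeauState (n + 1) L (Fin.snoc X y)
      refine mul_nonneg (by positivity) (integral_nonneg fun X => ?_)
      exact mul_nonneg (girardeauState_nonneg _ _ _) (girardeauState_nonneg _ _ _)

/-- `c₀(N) ≥ 0`. [folklore] -/
theorem zeroMomentumOccupation_nonneg (N : ℕ) (hL : 0 < L) : 0 ≤ zeroMomentumOccupation N L := by
  unfold zeroMomentumOccupation
  refine mul_nonneg (inv_nonneg.mpr hL.le) (integral_nonneg fun x => integral_nonneg fun y => ?_)
  exact girardeauDensityMatrix_nonneg _ _ _ _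

/-- `‖u(a)‖² = n + 1`. [folklore] -/
theorem sum_norm_sq_uVec (n : ℕ) (L a : ℝ) : ∑ p, ‖uVec n L a p‖ ^ 2 = (n + 1 : ℝ) := by
  simp [uVec, norm_pow, norm_eL]

/-- **The density-matrix bound.** For `a, b ∈ [0, L]`,
`ρ_{n+1}(a, b) ≤ ((n+1)/L) · e^{1/2} · exp(−2 V_{n+1}(a, b))`.
(proved here; much weaker than the printed `ρ_∞ √N |sin t|^{-1/2}` law
[cite: ForresterEtAl2003, §2.1.4]) [folklore] -/
theorem girardeauDensityMatrix_le_exp_numVar (hL : 0 < L) (ha : a ∈ Set.Icc 0 L)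
    (hb : b ∈ Set.Icc 0 L) :
    girardeauDensityMatrix (n + 1) L a b ≤
      (n + 1 : ℝ) / L * Real.exp (1 / 2) * Real.exp (-2 * numVar (n + 1) L a b) := by
  have hρ := density_eq_adjugate (n := n) hL ha hb
  set B : ℂ := star (uVec n L b) ⬝ᵥ ((lenardMatrix n L a b).adjugate *ᵥ uVec n L a) with hB
  set Φ : ℂ := cexp (↑(π * (a - b) / L) * I) with hΦ
  have hΦn : ‖(Φ ^ n)⁻¹‖ = 1 := by
    rw [norm_inv, norm_pow, hΦ, norm_exp_ofReal_mul_I, one_pow, inv_one]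
  have hnorm : ‖(girardeauDensityMatrix (n + 1) L a b : ℂ)‖ = L⁻¹ * ‖B‖ := by
    rw [hρ, norm_mul, norm_mul, hΦn, one_mul, norm_inv, Complex.norm_real, Real.norm_eq_abs,
      abs_of_pos hL]
  have hBle : ‖B‖ ≤ Real.exp (1 / 2) * Real.exp (-2 * numVar (n + 1) L a b) * (n + 1 : ℝ) := by
    have h := norm_star_dotProduct_adjugate_mulVec_le (lenardMatrix_isHermitian n L a b)
      (uVec n L b) (uVec n L a)
    rw [sum_norm_sq_uVec, sum_norm_sq_uVec, Fintype.card_fin, ← Real.sqrt_mul (by positivity),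
      Real.sqrt_mul_self (by positivity)] at h
    have htr : (Complex.re ((lenardMatrix n L a b * lenardMatrix n L a b).trace) -
        ((n + 1 : ℕ) : ℝ)) / 2 = -2 * numVar (n + 1) L a b := by
      rw [re_trace_lenardMatrix_sq]; ring
    rw [htr] at h
    exact h
  calc girardeauDensityMatrix (n + 1) L a b
      ≤ ‖(girardeauDensityMatrix (n + 1) L a b : ℂ)‖ := by
        rw [Complex.norm_real, Real.norm_eq_abs]; exact le_abs_self _
    _ = L⁻¹ * ‖B‖ := hnorm
    _ ≤ L⁻¹ * (Real.exp (1 / 2) * Real.exp (-2 * numVar (n + 1) L a b) * (n + 1 : ℝ)) :=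
        mul_le_mul_of_nonneg_left hBle (inv_nonneg.mpr hL.le)
    _ = (n + 1 : ℝ) / L * Real.exp (1 / 2) * Real.exp (-2 * numVar (n + 1) L a b) := by ring

/-- The explicit majorant `g_N(x, y) = exp(−sin²(π(x−y)/L) H_N / (9π²))`, `H_N = ∑_{j<N} 1/(j+1)`. [folklore] -/
def majorant (L : ℝ) (N : ℕ) (x y : ℝ) : ℝ :=
  Real.exp (-(Real.sin (π * (x - y) / L) ^ 2 / (9 * π ^ 2)) * ∑ j ∈ Finset.range N, 1 / ((j : ℝ) + 1))

/-- The majorant is jointly continuous. [folklore] -/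
theorem continuous_majorant (L : ℝ) (N : ℕ) : Continuous (Function.uncurry (majorant L N)) := by
  unfold majorant Function.uncurry
  fun_prop

/-- The majorant is non-negative. [folklore] -/
theorem majorant_nonneg (L : ℝ) (N : ℕ) (x y : ℝ) : 0 ≤ majorant L N x y := (Real.exp_pos _).le

/-- The majorant is at most `1`. [folklore] -/
theorem majorant_le_one (L : ℝ) (N : ℕ) (x y : ℝ) : majorant L N x y ≤ 1 := by
  unfold majorant
  rw [Real.exp_le_one_iff, neg_mul, neg_nonpos]
  exact mul_nonneg (by positivity) (Finset.sum_nonneg fun j _ => by positivity)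

/-- The pointwise bound `ρ_N(x, y) ≤ (N/L) e^{1/2} g_N(x, y)` on `[0, L]²`. [folklore] -/
theorem girardeauDensityMatrix_le_majorant (hL : 0 < L) (ha : a ∈ Set.Icc 0 L)
    (hb : b ∈ Set.Icc 0 L) :
    girardeauDensityMatrix (n + 1) L a b ≤
      (n + 1 : ℝ) / L * Real.exp (1 / 2) * majorant L (n + 1) a b := by
  refine (girardeauDensityMatrix_le_exp_numVar hL ha hb).trans ?_
  apply mul_le_mul_of_nonneg_left _ (by positivity)
  unfold majorant
  apply Real.exp_le_exp.mpr
  have h := numVar_ge_harmonic hL ha hb (n + 1)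
  have h9 : Real.sin (π * (a - b) / L) ^ 2 / (9 * π ^ 2) =
      2 * (Real.sin (π * (a - b) / L) ^ 2 / (18 * π ^ 2)) := by ring
  rw [h9]
  linarith

/-- `c₀(N)/N ≤ (e^{1/2}/L²) ∫₀ᴸ∫₀ᴸ g_N`. [folklore] -/
theorem zeroMomentumOccupation_div_le (hL : 0 < L) (n : ℕ) :
    zeroMomentumOccupation (n + 1) L / (n + 1 : ℕ) ≤
      Real.exp (1 / 2) / L ^ 2 *
        ∫ x in Set.Icc 0 L, ∫ y in Set.Icc 0 L, majorant L (n + 1) x y := by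
  set K : ℝ := (n + 1 : ℝ) / L * Real.exp (1 / 2) with hK
  have hK0 : 0 ≤ K := by positivity
  -- inner bound
  have hinner : ∀ x ∈ Set.Icc (0 : ℝ) L,
      ∫ y in Set.Icc 0 L, girardeauDensityMatrix (n + 1) L x y ≤
        ∫ y in Set.Icc 0 L, K * majorant L (n + 1) x y := by
    intro x hx
    refine integral_mono_of_nonneg (Filter.Eventually.of_forall fun y =>
      girardeauDensityMatrix_nonneg _ _ _ _) ?_ ?_
    · exact (continuous_const.mul ((continuous_majorant L (n + 1)).comp
        (continuous_const.prodMk continuous_id))).integrableOn_Icc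
    · exact ae_restrict_of_forall_mem measurableSet_Icc fun y hy =>
        girardeauDensityMatrix_le_majorant hL hx hy
  have hG_cont : Continuous fun x => ∫ y in Set.Icc 0 L, K * majorant L (n + 1) x y :=
    continuous_parametric_integral_of_continuous
      (continuous_const.mul (continuous_majorant L (n + 1))) isCompact_Icc
  have houter : ∫ x in Set.Icc 0 L, ∫ y in Set.Icc 0 L, girardeauDensityMatrix (n + 1) L x y ≤
      ∫ x in Set.Icc 0 L, ∫ y in Set.Icc 0 L, K * majorant L (n + 1) x y := by
    refine integral_mono_of_nonneg (Filter.Eventually.of_forall fun x =>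
      integral_nonneg fun y => girardeauDensityMatrix_nonneg _ _ _ _) hG_cont.integrableOn_Icc ?_
    exact ae_restrict_of_forall_mem measurableSet_Icc hinner
  unfold zeroMomentumOccupation
  simp_rw [integral_const_mul] at houter
  rw [div_le_iff₀ (by positivity)]
  calc L⁻¹ * ∫ x in Set.Icc 0 L, ∫ y in Set.Icc 0 L, girardeauDensityMatrix (n + 1) L x y
      ≤ L⁻¹ * (K * ∫ x in Set.Icc 0 L, ∫ y in Set.Icc 0 L, majorant L (n + 1) x y) :=
        mul_le_mul_of_nonneg_left houter (inv_nonneg.mpr hL.le)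
    _ = Real.exp (1 / 2) / L ^ 2 *
          (∫ x in Set.Icc 0 L, ∫ y in Set.Icc 0 L, majorant L (n + 1) x y) * ((n + 1 : ℕ) : ℝ) := by
        rw [hK]; push_cast; field_simp

/-- The inner majorant integrals tend to zero (dominated convergence; the integrand tends to
zero off the countable set `x + Lℤ`). [folklore] -/
theorem tendsto_inner_majorant (hL : 0 < L) (x : ℝ) :
    Tendsto (fun N => ∫ y in Set.Icc 0 L, majorant L N x y) atTop (𝓝 0) := by
  have hbad : ({y : ℝ | Real.sin (π * (x - y) / L) = 0}).Countable := by
    have : {y : ℝ | Real.sin (π * (x - y) / L) = 0} ⊆ Set.range fun k : ℤ => x - k * L := by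
      intro y hy
      obtain ⟨k, hk⟩ := Real.sin_eq_zero_iff.mp hy
      refine ⟨k, ?_⟩
      have hL0 : L ≠ 0 := hL.ne'
      have h3 : (k : ℝ) * L = x - y := by
        have : (k : ℝ) * π * L / π = π * (x - y) / L * L / π := by rw [hk]
        rwa [show (k : ℝ) * π * L / π = k * L by field_simp,
          show π * (x - y) / L * L / π = x - y by field_simp] at this
      simp only
      linarith
    exact (Set.countable_range _).mono this
  have hae : ∀ᵐ y ∂(volume.restrict (Set.Icc (0 : ℝ) L)),
      Tendsto (fun N => majorant L N x y) atTop (𝓝 0) := by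
    have h0 : (volume.restrict (Set.Icc (0 : ℝ) L)) {y : ℝ | Real.sin (π * (x - y) / L) = 0} = 0 :=
      hbad.measure_zero _
    filter_upwards [compl_mem_ae_iff.mpr h0] with y hy
    simp only [Set.mem_compl_iff, Set.mem_setOf_eq] at hy
    have hc : 0 < Real.sin (π * (x - y) / L) ^ 2 / (9 * π ^ 2) := by positivity
    unfold majorant
    have h1 : Tendsto (fun N => Real.sin (π * (x - y) / L) ^ 2 / (9 * π ^ 2) *
        ∑ j ∈ Finset.range N, 1 / ((j : ℝ) + 1)) atTop atTop :=
      Tendsto.const_mul_atTop hc Real.tendsto_sum_range_one_div_nat_succ_atTop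
    simp only [neg_mul]
    exact Real.tendsto_exp_comp_nhds_zero.mpr (tendsto_neg_atTop_atBot.comp h1)
  have h := tendsto_integral_of_dominated_convergence (μ := volume.restrict (Set.Icc (0 : ℝ) L))
    (F := fun N y => majorant L N x y) (f := fun _ => 0) (fun _ => 1)
    (fun N => ((continuous_majorant L N).comp (continuous_const.prodMk continuous_id)
      |>.aestronglyMeasurable))
    (integrable_const _)
    (fun N => Filter.Eventually.of_forall fun y => by
      rw [Real.norm_eq_abs, abs_of_nonneg (majorant_nonneg _ _ _ _)]
      exact majorant_le_one _ _ _ _)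
    hae
  simpa using h

/-- The double majorant integral tends to zero. [folklore] -/
theorem tendsto_double_majorant (hL : 0 < L) :
    Tendsto (fun N => ∫ x in Set.Icc 0 L, ∫ y in Set.Icc 0 L, majorant L N x y) atTop (𝓝 0) := by
  have h := tendsto_integral_of_dominated_convergence (μ := volume.restrict (Set.Icc (0 : ℝ) L))
    (F := fun N x => ∫ y in Set.Icc 0 L, majorant L N x y) (f := fun _ => 0) (fun _ => L)
    (fun N => (continuous_parametric_integral_of_continuous (μ := volume)
      (continuous_majorant L N) isCompact_Icc).aestronglyMeasurable)
    (integrable_const _)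
    (fun N => Filter.Eventually.of_forall fun x => by
      have := norm_setIntegral_le_of_norm_le_const
        (measure_Icc_lt_top (μ := (volume : Measure ℝ)) (a := (0 : ℝ)) (b := L))
        (f := fun y => majorant L N x y) (C := 1) fun y _ => by
          rw [Real.norm_eq_abs, abs_of_nonneg (majorant_nonneg _ _ _ _)]
          exact majorant_le_one _ _ _ _
      rwa [Real.volume_real_Icc_of_le hL.le, sub_zero, one_mul] at this)
    (Filter.Eventually.of_forall fun x => tendsto_inner_majorant hL x)
  simpa using h

end Assembly

end Literature.Barriers.AtomisticToContinuum.BoseGas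

/-! ### The barrier fact -/

namespace Literature.Barriers.AtomisticToContinuum

open BoseGas

/-- **Discharge of the barrier fact** `OneDimensionalHardCore`: the zero-momentum occupation of
the Girardeau ground state is `o(N)`.  Proof: Lenard's determinant formula (here in adjugate
form, `density_eq_adjugate`), the operator bound `norm_star_dotProduct_adjugate_mulVec_le`, and
the logarithmic divergence of the free-fermion number variance (`numVar_ge_harmonic`, via
Bessel's inequality), followed by dominated convergence.
[cite: ForresterEtAl2003, §2.1.1–2.1.2 (Girardeau state, Lenard's Toeplitz/Heine identity),
§2.2.2 (the printed sharper law `c₀(N) ∼ 1.5427 √N`)] -/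
theorem OneDimensionalHardCore_holds : OneDimensionalHardCore := by
  intro L hL
  have hupper : Tendsto (fun N : ℕ => Real.exp (1 / 2) / L ^ 2 *
      ∫ x in Set.Icc 0 L, ∫ y in Set.Icc 0 L, majorant L N x y) atTop (𝓝 0) := by
    simpa using (tendsto_double_majorant hL).const_mul (Real.exp (1 / 2) / L ^ 2)
  refine tendsto_of_tendsto_of_tendsto_of_le_of_le' tendsto_const_nhds hupper ?_ ?_
  · exact Filter.Eventually.of_forall fun N =>
      div_nonneg (zeroMomentumOccupation_nonneg N hL) (Nat.cast_nonneg N)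
  · rw [Filter.eventually_atTop]
    refine ⟨1, fun N hN => ?_⟩
    obtain ⟨n, rfl⟩ := Nat.exists_eq_succ_of_ne_zero (Nat.one_le_iff_ne_zero.mp hN)
    exact zeroMomentumOccupation_div_le hL n

end Literature.Barriers.AtomisticToContinuum
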